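/-
Copyright: public-domain mathematics; formalisation produced inside the b2b autopsy cell `lwe-quantum-autopsy`
(Part 1, generation 16).  Source analysed: Yilei Chen, "Quantum Algorithms for Lattice Problems",
IACR ePrint 2024/555, version of 2024-04-18 (WITHDRAWN by the author: "Step 9 of the algorithm contains a
bug, which I don't know how to fix").  Bib key `ChenQuantumLattice2024`.
REPRODUCTION / ANALYSIS OF A CLAIMED RESULT UNDER ADJUDICATION (withdrawn).
-/
import Literature.Computability.Cryptography.ChenQuantumLWEThresholdLargestPrime

/-!
# Chen (2024), Step 8: the EXACT tolerance threshold `1/(Q² + 1)` of the measurement ceiling (prime `Q ≥ 13`)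

REPRODUCTION / ANALYSIS OF A CLAIMED RESULT UNDER ADJUDICATION (withdrawn).  HONEST FRAMING: every
statement below is a theorem ABOUT the Step-8 register state `|φ7.d⟩` (eq. (35), Lemma 3.13) of Chen's
withdrawn quantum algorithm for LWE; the value is a THEOREM (an exact constant in a negative result about a
withdrawn algorithm) — it is NOT progress on LWE, on any lattice problem, or on quantum advantage, and it
neither repairs nor further breaks the algorithm (the bug is the false premise of Lemma 2.17 invoked in
Step 9, see `ChenQuantumLWEStepNine`, `ChenQuantumLWEHonestStepNine`).

## What was open

(P) `ChenQuantumLWERobustMeasurement` / (Q) `ChenQuantumLWEMeasurementThreshold` / (Y), (Z)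
`ChenQuantumLWEThresholdOrder`, `ChenQuantumLWEThresholdLargestPrime` established the MEASUREMENT CEILING of
Step 8: for an admissible instance `S` and the class of admissible instances of the same shape (unknown
coordinates `U ∋ t₁ + 1`), every POVM `E` on the Step-8 register that is `ε`-ALMOST SURE on the class (on
`|φ7.d⟩` of every instance some outcome has weight `≥ (1 − ε)⟨φ7.d|φ7.d⟩`) gives `S` and the admissible
instance `(b, v′ + 2D²p₁b)` — same `b`, same `step8Output`, different `step9Needs` — the SAME almost-certain
outcome, as soon as `ε` is below a threshold of order `1/Q²`: (Q) proved the ceiling for `4εQ² < 1` and its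
failure at `ε = 1/minFac(Q)²`; (Z) replaced `Q` by the largest prime factor `𝔭(Q)` (`32ε𝔭(Q)² ≤ 1`).  For
PRIME `Q` this left the constant in the window `[1/(4Q²), 1/Q²]` — (Q), scope note (b): "the exact threshold
is not determined: the factor `4` … remain[s] OPEN".  This module closes it for every prime `Q ≥ 13`:

* `Shape.step8_povm_ceiling_prime` — ceiling for every `ε` with `ε·(Q² + 1) < 1`;
* `Shape.step8_povm_ceiling_fails_at_threshold` — for EVERY admissible `Q` (prime or not) and every `U`, an
  explicit two-outcome POVM that is `ε⋆`-almost sure on the class at `ε⋆ = 1/(minFac(Q)² + 1)` and separates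
  `S` from `(b, v′ + 2D²p₁b)` (improving the failure point `1/minFac(Q)²` of (Q));
* `Shape.step8_povm_ceiling_threshold_prime` — the conjunction for prime `Q ≥ 13` (`minFac Q = Q`);
* `Shape.step8_povm_sameOutcome_iff_lt_threshold` — for prime `Q ≥ 13`, two-outcome measurements: the
  same-outcome conclusion holds for every `ε`-almost-sure `E` IFF `ε < 1/(Q² + 1)`.

So for prime `Q ≥ 13` the tolerance threshold of the Step-8 measurement ceiling is EXACTLY `1/(Q² + 1)`.

## The mechanism (Parts I–III): `Q` mutually unbiased orthogonal frames and one Gram step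

Fix the unknown tail coordinate `τ = t₁` and a base point.  Inside the class, the `Q³` kets
`bKet τ g x w` (dummy slope `g·e_τ`, `g ∈ ℤ_Q`; box coordinates `(x, w_τ) ∈ ℤ_Q²`) are `|φ7.d⟩` of
admissible instances ((Z) `Shape.exists_almostCertain_uKet`), and for PRIME `Q` they form `Q` orthogonal
frames `z g` (`g ∈ ℤ_Q`) of `Q²` vectors of common norm² `a`, any two of which are MUTUALLY UNBIASED:
`|⟨z g j | z g′ j′⟩|² = a²/Q²` for `g ≠ g′` (`Shape.normSq_bKet_bKet_of_isUnit`, `Shape.slopeBlock`; for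
composite `Q` the slopes `g − g′ ∉ (ℤ_Q)ˣ` are only partially unbiased, which is why (Z) pays `𝔭(Q)`).
`S` itself is `z 0 (x₀, w₀τ)` and `(b, v′ + 2D²p₁b)` lies in a frame of unit slope (`Shape.zKet_eq_bKet`,
(Y) `phi7d_shift_eq_uKet`).  The abstract statement `MUBFrames.sameOutcome` (Part III) is then: for `q ≥ 13`
MUB frames in which EVERY vector has an `ε`-almost-certain outcome and `ε(q² + 1) < 1`, all vectors of all
frames have the SAME almost-certain outcome.  Its proof, for the effect `A = E_k` of one outcome:
1. TRACE IDENTITY (`MUBFrames.trace_eq`): `Σ_j ⟨z g j|A|z g j⟩` is the same for every frame `g` (both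
   equal `a·tr(A|span)`; Bessel/Parseval inside the common span, `MUBFrames.expand`).
2. UPPER BOUND (`trace_le`): with `h_g = #{j : z g j is A-high}`, the frame-`g` trace is
   `≤ h_g·a + (q² − h_g)·εa` (a vector that is almost certain for ANOTHER outcome has `A`-weight `≤ εa`).
3. LOWER BOUND by a GRAM STEP (`sum_normSq_dotProduct_le_of_gram`, `trace_ge_gram`): one `A`-high vector
   `u` anywhere forces `Σ_g Σ_j |⟨z g j|√A u⟩|² ≥ …`, whence `q²(1 − ε)a ≤ (2q − 1)·(frame trace)`; with
   `q ≥ 13` and `ε(q² + 1) < 1` this gives `h_g ≥ 6` in EVERY frame (`six_le_card`).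
4. BLOCK INEQUALITY (`block_ineq`, the AM–GM split `re_quadForm_add_le` with `t = 2/5` of the PSD form of
   `A` along the decomposition of an `A`-high vector of frame `r` into its components on the `A`-high and
   the `A`-low vectors of frame `s`): `#F(1 − ε)a ≤ #F·(7/5)(h_s a/q²) + (7/2)(q² − h_s)εa` for any set `F`
   of `A`-high vectors of frame `r ≠ s`; with `#F ≥ 6` and `εq² < 1 − ε` it yields `h_s > q²/2`
   (`half_lt_card`).
5. PIGEONHOLE (`sameOutcome`): if outcomes `k ≠ k′` were both attained, some frame would be more than half
   `E_k`-high and more than half `E_{k′}`-high, so one vector would be almost certain for two outcomes,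
   impossible for `ε < 1/2` ((P) `POVM.almostCertain_unique`).
The threshold `ε(q² + 1) < 1`, i.e. `εq² < 1 − ε`, is exactly what Step 4 consumes; Part VI shows it
cannot be weakened.

## Sharpness (Part VI): the damped rank-one witness

`inst_phi7d_eq_or_overlap_le`: seen from `ψ = |φ7.d⟩` of `S`, every admissible instance of the shape is
either the SAME state or has normalised overlap² `≤ 1/minFac(Q)²` with `ψ` (the geometric content of (Q)
`Shape.rankOne_almostSureOn`).  DAMPING the rank-one measurement along `ψ` — effects
`(1 − ε⋆)·|ψ⟩⟨ψ|/⟨ψ|ψ⟩` and its complement (`POVM.damp`) — with `ε⋆ = 1/(minFac(Q)² + 1)` makes outcome `0`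
exactly `ε⋆`-almost certain on `ψ` and outcome `1` `ε⋆`-almost certain on every other instance, because
`1 − (1 − ε⋆)/minFac(Q)² = 1 − ε⋆`; and `(b, v′ + 2D²p₁b)` is orthogonal to `ψ` ((Q) `Shape.rankOne_separates`).

## What is NOT claimed

* Primes `3 ≤ Q ≤ 11`: the Gram step only gives `h_g ≥ 5` at `q = 11`, and the argument does not close;
  the window there is `[1/(4Q²), 1/(Q² + 1)]` ((Q) ceiling, Part VI failure).  Composite `Q`: ceiling
  `32ε𝔭(Q)² ≤ 1` of (Z), failure at `min(1/𝔭(Q)², 1/(minFac(Q)² + 1))` ((Y), Part VI) — the exact constant is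
  open.  Measurements with more than two outcomes at `ε ≥ 1/(Q² + 1)`: only the two-outcome `iff` is stated.
* Nothing here bears on Steps 1–7 (the complex-Gaussian front end is taken as the black box (N)
  `ChenQuantumLWEStepEight` records) or on the Step-9 bug itself.

Conventions: amplitude vectors `X → ℂ` with `⟨u|v⟩ = star u ⬝ᵥ v`; POVMs, weights, `Certain`,
`AlmostCertain`, `AlmostSureOn`, `rankOnePOVM` from (O), (P), (Q); frames `frameProj` from (Z).
[cite: ChenQuantumLattice2024, Lemma 3.13 pp. 32–34, eq. (35) p. 31, §3.5.8 pp. 33–34, §3.5.9 p. 37,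
Cond. C.3–C.5 p. 18; NielsenChuang2010, §2.2.6 p. 90, Box 2.3 p. 87]
-/

open scoped BigOperators ComplexOrder MatrixOrder
open Matrix Finset

namespace Literature.Computability.Cryptography.Chen2024

/-! ## Part I.  Inequalities for amplitude vectors and positive semidefinite forms -/

section PSD

variable {X : Type*} [Fintype X]

/-- `re ⟨v|v⟩ = Σ_ξ ‖v_ξ‖²`. [folklore] -/
theorem re_star_dotProduct_self (v : X → ℂ) : (star v ⬝ᵥ v).re = ∑ ξ, ‖v ξ‖ ^ 2 := by
  simp only [dotProduct, Pi.star_apply, Complex.star_def, conj_mul_self_eq_norm_sq, Complex.re_sum,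
    Complex.ofReal_re]

/-- `re ⟨a + b|a + b⟩ = re⟨a|a⟩ + re⟨b|b⟩ + 2·re⟨a|b⟩`. [folklore] -/
theorem re_star_add_dotProduct_add (u w : X → ℂ) :
    (star (u + w) ⬝ᵥ (u + w)).re = (star u ⬝ᵥ u).re + (star w ⬝ᵥ w).re + 2 * (star u ⬝ᵥ w).re := by
  have hc : star w ⬝ᵥ u = (starRingEnd ℂ) (star u ⬝ᵥ w) := (conj_star_dotProduct u w).symm
  rw [star_add, add_dotProduct, dotProduct_add, dotProduct_add, Complex.add_re, Complex.add_re,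
    Complex.add_re, hc, Complex.conj_re]
  ring

/-- **AM–GM splitting of a norm:** `‖a + b‖² ≤ (1 + t)‖a‖² + (1 + 1/t)‖b‖²` for every `t > 0`. [folklore] -/
theorem re_star_add_dotProduct_add_le (u w : X → ℂ) {t : ℝ} (ht : 0 < t) :
    (star (u + w) ⬝ᵥ (u + w)).re ≤ (1 + t) * (star u ⬝ᵥ u).re + (1 + 1 / t) * (star w ⬝ᵥ w).re := by
  rw [re_star_add_dotProduct_add]
  set P := (star u ⬝ᵥ u).re with hP
  set R := (star w ⬝ᵥ w).re with hR
  set z := star u ⬝ᵥ w with hz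
  have hP0 : 0 ≤ P := star_dotProduct_self_re_nonneg u
  have hR0 : 0 ≤ R := star_dotProduct_self_re_nonneg w
  have hcs : ‖z‖ ^ 2 ≤ P * R := norm_sq_star_dotProduct_le u w
  have hre : z.re ^ 2 ≤ ‖z‖ ^ 2 := by
    rw [Complex.sq_norm, Complex.normSq_apply]
    nlinarith [sq_nonneg z.im]
  -- `2 re z ≤ t P + R / t`
  have key : 2 * z.re ≤ t * P + R / t := by
    have hsum : 0 ≤ t * P + R / t := by positivity
    have h4 : (2 * z.re) ^ 2 ≤ (t * P + R / t) ^ 2 := by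
      have h1 : (2 * z.re) ^ 2 ≤ 4 * (P * R) := by nlinarith
      have h2 : 4 * (P * R) ≤ (t * P + R / t) ^ 2 := by
        have : (t * P + R / t) ^ 2 - 4 * (P * R) = (t * P - R / t) ^ 2 := by
          field_simp
          ring
        nlinarith [sq_nonneg (t * P - R / t)]
      exact h1.trans h2
    exact abs_le_of_sq_le_sq' h4 hsum |>.2
  have h1t : (1 + 1 / t) * R = R + R / t := by ring
  nlinarith

variable [DecidableEq X]

/-- A positive semidefinite matrix is `B†B`; its form is `⟨x|A|y⟩ = ⟨Bx|By⟩`. [folklore] -/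
theorem exists_form_eq_of_posSemidef {A : Matrix X X ℂ} (hA : A.PosSemidef) :
    ∃ B : Matrix X X ℂ, ∀ x y : X → ℂ, star x ⬝ᵥ (A *ᵥ y) = star (B *ᵥ x) ⬝ᵥ (B *ᵥ y) := by
  obtain ⟨B, rfl⟩ := CStarAlgebra.nonneg_iff_eq_star_mul_self.mp hA.nonneg
  refine ⟨B, fun x y => ?_⟩
  rw [← Matrix.mulVec_mulVec, dotProduct_mulVec, star_eq_conjTranspose, vecMul_conjTranspose, star_star]

/-- **AM–GM splitting of a positive semidefinite form:** `⟨p + r|A|p + r⟩ ≤ (1 + t)⟨p|A|p⟩ + (1 + 1/t)⟨r|A|r⟩`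
for every `t > 0`. [folklore] -/
theorem re_quadForm_add_le {A : Matrix X X ℂ} (hA : A.PosSemidef) (p r : X → ℂ) {t : ℝ} (ht : 0 < t) :
    (star (p + r) ⬝ᵥ (A *ᵥ (p + r))).re
      ≤ (1 + t) * (star p ⬝ᵥ (A *ᵥ p)).re + (1 + 1 / t) * (star r ⬝ᵥ (A *ᵥ r)).re := by
  obtain ⟨B, hB⟩ := exists_form_eq_of_posSemidef hA
  rw [hB, hB, hB, Matrix.mulVec_add]
  exact re_star_add_dotProduct_add_le _ _ ht

omit [DecidableEq X] in
/-- The coordinate `ξ` of `B x` is the inner product with the conjugate row: `(Bx)_ξ = ⟨row_ξ(B)†|x⟩`. [folklore] -/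
theorem mulVec_apply_eq_star_dotProduct (B : Matrix X X ℂ) (x : X → ℂ) (ξ : X) :
    (B *ᵥ x) ξ = star (star (B ξ)) ⬝ᵥ x := by
  rw [star_star]
  rfl

omit [DecidableEq X] in
/-- `re⟨Bx|Bx⟩ = Σ_ξ ‖⟨row_ξ(B)†|x⟩‖²`. [folklore] -/
theorem re_star_mulVec_dotProduct_mulVec (B : Matrix X X ℂ) (x : X → ℂ) :
    (star (B *ᵥ x) ⬝ᵥ (B *ᵥ x)).re = ∑ ξ, ‖star (star (B ξ)) ⬝ᵥ x‖ ^ 2 := by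
  rw [re_star_dotProduct_self]
  exact Finset.sum_congr rfl fun ξ _ => by rw [mulVec_apply_eq_star_dotProduct]

/-! ### The Schur test: `Σ_i ‖⟨v_i|g⟩‖² ≤ Λ·‖g‖²` with `Λ` a row-sum bound of the Gram matrix -/

omit [DecidableEq X] in
/-- **Schur / Gershgorin test.**  If every row of the Gram matrix of the vectors `v_i` has absolute sum at
most `Λ`, then `Σ_i ‖⟨v_i|g⟩‖² ≤ Λ·⟨g|g⟩` for every vector `g` (the frame operator `Σ|v_i⟩⟨v_i|` is bounded
by `λ_max(Gram) ≤ Λ`). [folklore] -/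
theorem sum_normSq_dotProduct_le_of_gram {I : Type*} [Fintype I] (v : I → X → ℂ) (g : X → ℂ) {Λ : ℝ}
    (hΛ0 : 0 ≤ Λ) (hΛ : ∀ i, ∑ i', ‖star (v i) ⬝ᵥ v i'‖ ≤ Λ) :
    ∑ i, ‖star (v i) ⬝ᵥ g‖ ^ 2 ≤ Λ * (star g ⬝ᵥ g).re := by
  let c : I → ℂ := fun i => star (v i) ⬝ᵥ g
  have hc : ∀ i, c i = star (v i) ⬝ᵥ g := fun i => rfl
  set y : X → ℂ := ∑ i, c i • v i with hy
  have hG : 0 ≤ (star g ⬝ᵥ g).re := star_dotProduct_self_re_nonneg g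
  have hS0 : 0 ≤ ∑ i, ‖c i‖ ^ 2 := Finset.sum_nonneg fun i _ => sq_nonneg _
  -- `⟨g|y⟩ = S`
  have hgy : star g ⬝ᵥ y = (((∑ i, ‖c i‖ ^ 2 : ℝ)) : ℂ) := by
    rw [hy, dotProduct_sum, Complex.ofReal_sum]
    refine Finset.sum_congr rfl fun i _ => ?_
    rw [dotProduct_smul, smul_eq_mul, hc i, ← conj_star_dotProduct (v i) g, mul_comm,
      conj_mul_self_eq_norm_sq]
  -- `re⟨y|y⟩ ≤ Λ S`
  have hyy : (star y ⬝ᵥ y).re ≤ Λ * ∑ i, ‖c i‖ ^ 2 := by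
    have hexp : star y ⬝ᵥ y = ∑ i, ∑ i', (starRingEnd ℂ) (c i) * c i' * (star (v i) ⬝ᵥ v i') := by
      rw [hy, star_sum, sum_dotProduct]
      refine Finset.sum_congr rfl fun i _ => ?_
      rw [dotProduct_sum]
      refine Finset.sum_congr rfl fun i' _ => ?_
      rw [star_smul, smul_dotProduct, dotProduct_smul, smul_eq_mul, smul_eq_mul, Complex.star_def]
      ring
    have h1 : (star y ⬝ᵥ y).re ≤ ∑ i, ∑ i', ‖c i‖ * ‖c i'‖ * ‖star (v i) ⬝ᵥ v i'‖ := by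
      rw [hexp]
      refine (Complex.re_le_norm _).trans ((norm_sum_le _ _).trans (Finset.sum_le_sum fun i _ => ?_))
      refine (norm_sum_le _ _).trans (Finset.sum_le_sum fun i' _ => ?_)
      rw [norm_mul, norm_mul, Complex.norm_conj]
    have h2 : ∑ i, ∑ i', ‖c i‖ * ‖c i'‖ * ‖star (v i) ⬝ᵥ v i'‖
        ≤ ∑ i, ∑ i', (‖c i‖ ^ 2 / 2) * ‖star (v i) ⬝ᵥ v i'‖
          + ∑ i, ∑ i', (‖c i'‖ ^ 2 / 2) * ‖star (v i) ⬝ᵥ v i'‖ := by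
      rw [← Finset.sum_add_distrib]
      refine Finset.sum_le_sum fun i _ => ?_
      rw [← Finset.sum_add_distrib]
      refine Finset.sum_le_sum fun i' _ => ?_
      have hn : 0 ≤ ‖star (v i) ⬝ᵥ v i'‖ := norm_nonneg _
      nlinarith [sq_nonneg (‖c i‖ - ‖c i'‖)]
    have h3 : ∑ i, ∑ i', (‖c i'‖ ^ 2 / 2) * ‖star (v i) ⬝ᵥ v i'‖
        = ∑ i, ∑ i', (‖c i‖ ^ 2 / 2) * ‖star (v i) ⬝ᵥ v i'‖ := by
      rw [Finset.sum_comm]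
      refine Finset.sum_congr rfl fun i _ => Finset.sum_congr rfl fun i' _ => ?_
      rw [norm_star_dotProduct_comm (v i') (v i)]
    have h4 : ∑ i, ∑ i', (‖c i‖ ^ 2 / 2) * ‖star (v i) ⬝ᵥ v i'‖ ≤ ∑ i, (‖c i‖ ^ 2 / 2) * Λ := by
      refine Finset.sum_le_sum fun i _ => ?_
      rw [← Finset.mul_sum]
      exact mul_le_mul_of_nonneg_left (hΛ i) (by positivity)
    have h5 : ∑ i, (‖c i‖ ^ 2 / 2) * Λ = Λ * (∑ i, ‖c i‖ ^ 2) / 2 := by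
      rw [← Finset.sum_mul, ← Finset.sum_div]
      ring
    linarith [h1, h2, h3, h4, h5]
  -- Cauchy–Schwarz: `S² ≤ ⟨g|g⟩⟨y|y⟩`
  set Sg : ℝ := ∑ i, ‖c i‖ ^ 2 with hSg
  have hcs : Sg ^ 2 ≤ (star g ⬝ᵥ g).re * (star y ⬝ᵥ y).re := by
    have := norm_sq_star_dotProduct_le g y
    rwa [hgy, Complex.norm_real, Real.norm_of_nonneg hS0] at this
  -- conclude
  show Sg ≤ Λ * (star g ⬝ᵥ g).re
  by_contra hcon
  push Not at hcon
  have hSpos : 0 < Sg := lt_of_le_of_lt (by positivity) hcon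
  have : Sg * Sg ≤ Sg * (Λ * (star g ⬝ᵥ g).re) := by
    calc Sg * Sg = Sg ^ 2 := by ring
      _ ≤ (star g ⬝ᵥ g).re * (star y ⬝ᵥ y).re := hcs
      _ ≤ (star g ⬝ᵥ g).re * (Λ * Sg) := mul_le_mul_of_nonneg_left hyy hG
      _ = Sg * (Λ * (star g ⬝ᵥ g).re) := by ring
  exact absurd (le_of_mul_le_mul_left this hSpos) (not_le.2 hcon)

end PSD

/-! ## Part II.  Frames again: self-adjointness of the projection, splitting along a sub-family, the Gram–trace bound -/

section Frame2

variable {X : Type*} [Fintype X] [DecidableEq X]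
variable {J : Type*} [Fintype J] [DecidableEq J]

omit [DecidableEq X] [DecidableEq J] in
/-- The frame projection is self-adjoint: `⟨P u|w⟩ = ⟨u|P w⟩`. [folklore] -/
theorem star_frameProj_dotProduct_eq (O : J → X → ℂ) (a : ℝ) (u w : X → ℂ) :
    star (frameProj O a u) ⬝ᵥ w = star u ⬝ᵥ frameProj O a w := by
  rw [star_frameProj_dotProduct, star_dotProduct_frameProj]
  refine Finset.sum_congr rfl fun j _ => ?_
  rw [conj_star_dotProduct]
  ring

omit [DecidableEq X] [DecidableEq J] in
/-- Splitting the frame expansion along a sub-family `W ⊆ J` and its complement: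
`P u = P_W u + P_{Wᶜ} u`. [folklore] -/
theorem frameProj_eq_add_subtype (O : J → X → ℂ) (a : ℝ) (W : J → Prop) [DecidablePred W] (u : X → ℂ) :
    frameProj O a u
      = frameProj (fun j : {j // W j} => O j.1) a u + frameProj (fun j : {j // ¬ W j} => O j.1) a u := by
  unfold frameProj
  exact (Fintype.sum_subtype_add_sum_subtype W (fun j => (((a : ℂ))⁻¹ * (star (O j) ⬝ᵥ u)) • O j)).symm

/-- **The Gram–trace bound.**  Let `(O_j)` be an orthogonal family of common norm² `a > 0`, `(v_i)` vectors
in its span whose Gram matrix has absolute row sums `≤ Λ`, and `A ≥ 0`.  Then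
`Σ_i ⟨v_i|A|v_i⟩ ≤ (Λ/a)·Σ_j ⟨O_j|A|O_j⟩` (`tr(A·Σ|v_i⟩⟨v_i|) ≤ ‖Σ|v_i⟩⟨v_i|‖·tr(A·P)`). [folklore] -/
theorem sum_re_quadForm_le_of_gram {I : Type*} [Fintype I] {A : Matrix X X ℂ} (hA : A.PosSemidef)
    (O : J → X → ℂ) {a : ℝ} (ha : 0 < a)
    (hO : ∀ j j', star (O j) ⬝ᵥ O j' = if j = j' then ((a : ℂ)) else 0)
    (v : I → X → ℂ) (hexp : ∀ i, v i = frameProj O a (v i)) {Λ : ℝ} (hΛ0 : 0 ≤ Λ)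
    (hΛ : ∀ i, ∑ i', ‖star (v i) ⬝ᵥ v i'‖ ≤ Λ) :
    ∑ i, (star (v i) ⬝ᵥ (A *ᵥ v i)).re ≤ Λ / a * ∑ j, (star (O j) ⬝ᵥ (A *ᵥ O j)).re := by
  classical
  obtain ⟨B, hB⟩ := exists_form_eq_of_posSemidef hA
  -- the conjugate rows of `B`
  set r : X → X → ℂ := fun ξ => star (B ξ) with hr
  have hL : ∑ i, (star (v i) ⬝ᵥ (A *ᵥ v i)).re = ∑ ξ, ∑ i, ‖star (v i) ⬝ᵥ frameProj O a (r ξ)‖ ^ 2 := by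
    rw [Finset.sum_comm]
    refine Finset.sum_congr rfl fun i _ => ?_
    rw [hB, re_star_mulVec_dotProduct_mulVec]
    refine Finset.sum_congr rfl fun ξ _ => ?_
    rw [norm_star_dotProduct_comm, ← star_frameProj_dotProduct_eq, ← hexp i]
  have hR : ∑ j, (star (O j) ⬝ᵥ (A *ᵥ O j)).re = ∑ ξ, ∑ j, ‖star (O j) ⬝ᵥ r ξ‖ ^ 2 := by
    rw [Finset.sum_comm]
    refine Finset.sum_congr rfl fun j _ => ?_
    rw [hB, re_star_mulVec_dotProduct_mulVec]
    refine Finset.sum_congr rfl fun ξ _ => ?_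
    rw [norm_star_dotProduct_comm]
  rw [hL, hR, Finset.mul_sum]
  refine Finset.sum_le_sum fun ξ _ => ?_
  have h1 := sum_normSq_dotProduct_le_of_gram v (frameProj O a (r ξ)) hΛ0 hΛ
  have h2 : (star (frameProj O a (r ξ)) ⬝ᵥ frameProj O a (r ξ)).re = a⁻¹ * ∑ j, ‖star (O j) ⬝ᵥ r ξ‖ ^ 2 := by
    rw [star_frameProj_self O ha hO, Complex.ofReal_re]
  rw [h2] at h1
  calc ∑ i, ‖star (v i) ⬝ᵥ frameProj O a (r ξ)‖ ^ 2 ≤ Λ * (a⁻¹ * ∑ j, ‖star (O j) ⬝ᵥ r ξ‖ ^ 2) := h1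
    _ = Λ / a * ∑ j, ‖star (O j) ⬝ᵥ r ξ‖ ^ 2 := by rw [div_eq_mul_inv]; ring

end Frame2

/-! ## Part III.  `q` mutually unbiased orthogonal frames of size `q²`: below `1/(q²+1)` an almost-sure
measurement is CONSTANT on all of them (`q ≥ 13`) -/

section MUB

variable {X : Type*} [Fintype X] [DecidableEq X]
variable {I J : Type*} [Fintype I] [DecidableEq I] [Fintype J] [DecidableEq J]

/-- `q` MUTUALLY UNBIASED ORTHOGONAL FRAMES of size `q²`: for each `i : I` (`#I = q`) an orthogonal family
`(z_{i,j})_{j : J}` (`#J = q²`) of common norm² `a > 0`, two vectors of DIFFERENT families having overlap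
`‖⟨z_{i,j}|z_{i′,j′}⟩‖² = (a/q)²` — so (Bessel) every family is an orthogonal basis of one and the same
`q²`-dimensional space, and the bases are pairwise unbiased. [folklore] [cite: NielsenChuang2010, Box 2.3 p. 87] -/
structure MUBFrames (q : ℕ) (a : ℝ) (z : I → J → X → ℂ) : Prop where
  apos : 0 < a
  qpos : 0 < q
  cardI : Fintype.card I = q
  cardJ : Fintype.card J = q ^ 2
  orth : ∀ i j j', star (z i j) ⬝ᵥ z i j' = if j = j' then ((a : ℂ)) else 0
  mub : ∀ i i', i ≠ i' → ∀ j j', ‖star (z i j) ⬝ᵥ z i' j'‖ ^ 2 = (a / q) ^ 2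

namespace MUBFrames

variable {q : ℕ} {a : ℝ} {z : I → J → X → ℂ}

omit [DecidableEq X] [DecidableEq I] in
/-- `re⟨z|z⟩ = a`. [folklore] -/
theorem re_self (hF : MUBFrames q a z) (i : I) (j : J) : (star (z i j) ⬝ᵥ z i j).re = a := by
  rw [hF.orth, if_pos rfl, Complex.ofReal_re]

omit [DecidableEq X] [DecidableEq I] in
/-- Frame vectors are non-zero. [folklore] -/
theorem ne_zero (hF : MUBFrames q a z) (i : I) (j : J) : z i j ≠ 0 := by
  intro h0
  have h := hF.re_self i j
  rw [h0, star_zero, zero_dotProduct, Complex.zero_re] at h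
  exact absurd h hF.apos.ne

omit [DecidableEq X] [DecidableEq I] in
/-- `‖⟨z_{i,j}|z_{i′,j′}⟩‖ = a/q` across families. [folklore] -/
theorem norm_mub (hF : MUBFrames q a z) {i i' : I} (h : i ≠ i') (j j' : J) :
    ‖star (z i j) ⬝ᵥ z i' j'‖ = a / q := by
  have h2 := hF.mub i i' h j j'
  have hn : 0 ≤ ‖star (z i j) ⬝ᵥ z i' j'‖ := norm_nonneg _
  have hq : 0 ≤ a / q := div_nonneg hF.apos.le (Nat.cast_nonneg _)
  exact (pow_left_inj₀ hn hq two_ne_zero).1 h2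

omit [DecidableEq X] [DecidableEq I] in
/-- **Bessel's equality** for a vector of one family over any family: `Σ_j ‖⟨z_{i,j}|z_{i′,j′}⟩‖² = a·⟨z|z⟩`.
[folklore] [cite: NielsenChuang2010, Box 2.3 p. 87] -/
theorem bessel (hF : MUBFrames q a z) (i i' : I) (j' : J) :
    ∑ j, ‖star (z i j) ⬝ᵥ z i' j'‖ ^ 2 = a * (star (z i' j') ⬝ᵥ z i' j').re := by
  rw [hF.re_self]
  by_cases h : i = i'
  · subst h
    rw [Finset.sum_eq_single j' (fun j _ hj => by
        rw [hF.orth, if_neg hj, norm_zero, zero_pow two_ne_zero]) (fun h => absurd (Finset.mem_univ _) h),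
      hF.orth, if_pos rfl, Complex.norm_real, Real.norm_of_nonneg hF.apos.le, sq]
  · simp_rw [hF.mub i i' h]
    rw [Finset.sum_const, Finset.card_univ, hF.cardJ, nsmul_eq_mul]
    have hq : (q : ℝ) ≠ 0 := by exact_mod_cast hF.qpos.ne'
    push_cast
    field_simp

omit [DecidableEq X] [DecidableEq I] in
/-- Every vector of every family lies in the span of every family: `z_{i′,j′} = P_i z_{i′,j′}`. [folklore] -/
theorem expand (hF : MUBFrames q a z) (i i' : I) (j' : J) : z i' j' = frameProj (z i) a (z i' j') :=
  eq_frameProj_of_bessel (z i) hF.apos (hF.orth i) _ (hF.bessel i i' j')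

omit [DecidableEq X] [DecidableEq I] in
/-- **Trace invariance:** `Σ_j ⟨z_{i,j}|A|z_{i,j}⟩` does not depend on the family `i` (both are `a·tr(A·P)`).
[folklore] -/
theorem trace_eq (hF : MUBFrames q a z) (A : Matrix X X ℂ) (i i' : I) :
    ∑ j, star (z i j) ⬝ᵥ (A *ᵥ z i j) = ∑ j, star (z i' j) ⬝ᵥ (A *ᵥ z i' j) := by
  have h := sum_star_frameProj_mulVec (z i) (z i') hF.apos (hF.orth i) (fun j => hF.expand i' i j) A
  rw [← h]
  exact Finset.sum_congr rfl fun v _ => by rw [← hF.expand i i' v]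

variable {κ : Type*} [Fintype κ] [DecidableEq κ]

omit [DecidableEq I] in
/-- If some outcome is `ε`-almost certain on a frame vector then `ε ≥ 0`. [folklore] -/
theorem eps_nonneg (hF : MUBFrames q a z) (E : POVM X κ) {ε : ℝ} {s : I} {j : J} {k : κ}
    (hk : E.AlmostCertain ε (z s j) k) : 0 ≤ ε := by
  have h1 := E.weight_re_le (z s j) k
  unfold POVM.AlmostCertain at hk
  rw [hF.re_self] at hk h1
  nlinarith [hF.apos]

omit [DecidableEq I] in
/-- A frame vector whose almost-certain outcome is NOT `A` carries `A`-weight at most `εa`.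
[cite: NielsenChuang2010, §2.2.6 p. 90] -/
theorem weight_re_le_of_not_ac (hF : MUBFrames q a z) (E : POVM X κ) {ε : ℝ} {s : I} {j : J} {A : κ}
    (hex : ∃ k, E.AlmostCertain ε (z s j) k) (hn : ¬ E.AlmostCertain ε (z s j) A) :
    (E.weight (z s j) A).re ≤ ε * a := by
  obtain ⟨k, hk⟩ := hex
  have hkA : k ≠ A := fun h => hn (h ▸ hk)
  have h2 := E.weight_re_add_weight_re_le (z s j) hkA
  unfold POVM.AlmostCertain at hk
  rw [hF.re_self] at h2 hk
  linarith

omit [DecidableEq I] in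
/-- Any weight of a frame vector is at most `a`. [cite: NielsenChuang2010, §2.2.6 p. 90] -/
theorem weight_re_le_a (hF : MUBFrames q a z) (E : POVM X κ) (s : I) (j : J) (A : κ) :
    (E.weight (z s j) A).re ≤ a := by
  have := E.weight_re_le (z s j) A
  rwa [hF.re_self] at this

omit [DecidableEq I] in
/-- **The frame trace from above:** with `W` the set of `A`-high vectors of family `s`,
`Σ_j ⟨z_{s,j}|E_A|z_{s,j}⟩ ≤ #W·a + (q² − #W)·εa`. [cite: NielsenChuang2010, §2.2.6 p. 90] -/
theorem trace_le (hF : MUBFrames q a z) (E : POVM X κ) {ε : ℝ} {s : I} {A : κ}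
    (hE : ∀ j, ∃ k, E.AlmostCertain ε (z s j) k)
    (W : Finset J) (hW : ∀ j, j ∈ W ↔ E.AlmostCertain ε (z s j) A) :
    ∑ j, (E.weight (z s j) A).re ≤ W.card * a + ((q : ℝ) ^ 2 - W.card) * (ε * a) := by
  classical
  have hsplit := (Finset.sum_filter_add_sum_filter_not Finset.univ (fun j => j ∈ W)
    fun j => (E.weight (z s j) A).re).symm
  have hf1 : Finset.univ.filter (fun j => j ∈ W) = W := by ext j; simp
  have hcard2 : ((Finset.univ.filter fun j => ¬ j ∈ W).card : ℝ) = (q : ℝ) ^ 2 - W.card := by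
    have h := Finset.card_filter_add_card_filter_not (s := Finset.univ) (fun j => j ∈ W)
    rw [hf1, Finset.card_univ, hF.cardJ] at h
    have h' : ((W.card + (Finset.univ.filter fun j => ¬ j ∈ W).card : ℕ) : ℝ) = ((q ^ 2 : ℕ) : ℝ) := by
      exact_mod_cast h
    push_cast at h'
    linarith
  rw [hsplit, hf1]
  have h1 : ∑ j ∈ W, (E.weight (z s j) A).re ≤ W.card * a := by
    have := Finset.sum_le_card_nsmul W (fun j => (E.weight (z s j) A).re) a
      (fun j _ => hF.weight_re_le_a E s j A)
    rwa [nsmul_eq_mul] at this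
  have h2 : ∑ j ∈ Finset.univ.filter (fun j => ¬ j ∈ W), (E.weight (z s j) A).re
      ≤ (Finset.univ.filter (fun j => ¬ j ∈ W)).card * (ε * a) := by
    have := Finset.sum_le_card_nsmul (Finset.univ.filter (fun j => ¬ j ∈ W))
      (fun j => (E.weight (z s j) A).re) (ε * a)
      (fun j hj => hF.weight_re_le_of_not_ac E (hE j)
        (fun h => (Finset.mem_filter.1 hj).2 ((hW j).2 h)))
    rwa [nsmul_eq_mul] at this
  rw [hcard2] at h2
  linarith

omit [DecidableEq I] [DecidableEq κ] in
/-- **The frame trace from below:** one `A`-high vector gives `(1 − ε)a ≤ Σ_j ⟨z_{s,j}|E_A|z_{s,j}⟩`.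
[cite: NielsenChuang2010, §2.2.6 p. 90] -/
theorem trace_ge (hF : MUBFrames q a z) (E : POVM X κ) {ε : ℝ} {s : I} {j : J} {A : κ}
    (hj : E.AlmostCertain ε (z s j) A) : (1 - ε) * a ≤ ∑ j', (E.weight (z s j') A).re := by
  unfold POVM.AlmostCertain at hj
  rw [hF.re_self] at hj
  exact hj.trans (Finset.single_le_sum (fun j' _ => E.weight_re_nonneg _ _) (Finset.mem_univ j))

omit [DecidableEq I] [DecidableEq κ] in
/-- The frame trace of an effect is the same in every family. [folklore] -/
theorem trace_weight_eq (hF : MUBFrames q a z) (E : POVM X κ) (A : κ) (s s' : I) :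
    ∑ j, (E.weight (z s j) A).re = ∑ j, (E.weight (z s' j) A).re := by
  have h := hF.trace_eq (E.effect A) s s'
  simp only [POVM.weight]
  rw [← Complex.re_sum, ← Complex.re_sum, h]

omit [DecidableEq I] in
/-- **Every family has an `A`-high vector** as soon as one frame vector anywhere is `A`-high and
`ε(q² + 1) < 1`: otherwise the trace would be at most `q²εa < (1 − ε)a`. [folklore] -/
theorem exists_ac (hF : MUBFrames q a z) (E : POVM X κ) {ε : ℝ} (hε : ε * ((q : ℝ) ^ 2 + 1) < 1)
    (hE : ∀ i j, ∃ k, E.AlmostCertain ε (z i j) k) {A : κ} {i₀ : I} {j₀ : J}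
    (hA : E.AlmostCertain ε (z i₀ j₀) A) (s : I) : ∃ j, E.AlmostCertain ε (z s j) A := by
  by_contra hno
  push Not at hno
  have h1 := hF.trace_ge E hA
  rw [hF.trace_weight_eq E A i₀ s] at h1
  have h2 := hF.trace_le E (A := A) (hE s) ∅
    (fun j => ⟨fun h => absurd h (Finset.notMem_empty j), fun h => absurd h (hno j)⟩)
  simp only [Finset.card_empty, Nat.cast_zero, zero_mul, zero_add, sub_zero] at h2
  have ha := hF.apos
  nlinarith

omit [DecidableEq I] [DecidableEq κ] in
/-- **The Gram step:** one `A`-high vector from each of the `q` families — pairwise overlaps `a/q`, Gram row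
sums `a(2q − 1)/q` — forces `(2q − 1)·Σ_j⟨z_{r,j}|E_A|z_{r,j}⟩ ≥ q²(1 − ε)a`. [folklore] -/
theorem trace_ge_gram (hF : MUBFrames q a z) (E : POVM X κ) {ε : ℝ} {A : κ}
    (hall : ∀ s, ∃ j, E.AlmostCertain ε (z s j) A) (r : I) :
    (q : ℝ) ^ 2 * ((1 - ε) * a) ≤ (2 * q - 1) * ∑ j, (E.weight (z r j) A).re := by
  classical
  choose sel hsel using hall
  set v : I → X → ℂ := fun i => z i (sel i) with hv
  have hq1 : 1 ≤ q := hF.qpos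
  have hqr : (0 : ℝ) < q := by exact_mod_cast hF.qpos
  have hrow : ∀ i, ∑ i', ‖star (v i) ⬝ᵥ v i'‖ = a + ((q : ℝ) - 1) * (a / q) := by
    intro i
    rw [← Finset.add_sum_erase Finset.univ _ (Finset.mem_univ i)]
    have h0 : ‖star (v i) ⬝ᵥ v i‖ = a := by
      rw [hv, hF.orth, if_pos rfl, Complex.norm_real, Real.norm_of_nonneg hF.apos.le]
    have hrest : ∑ i' ∈ Finset.univ.erase i, ‖star (v i) ⬝ᵥ v i'‖ = ((q : ℝ) - 1) * (a / q) := by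
      rw [Finset.sum_congr rfl fun i' hi' => hF.norm_mub (Ne.symm (Finset.ne_of_mem_erase hi')) (sel i) (sel i'),
        Finset.sum_const, Finset.card_erase_of_mem (Finset.mem_univ i), Finset.card_univ, hF.cardI,
        nsmul_eq_mul, Nat.cast_sub hq1, Nat.cast_one]
    rw [h0, hrest]
  have hΛ0 : 0 ≤ a + ((q : ℝ) - 1) * (a / q) := by
    have : (1 : ℝ) ≤ q := by exact_mod_cast hq1
    have := hF.apos
    positivity
  have hG := sum_re_quadForm_le_of_gram (E.posSemidef A) (z r) hF.apos (hF.orth r) v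
    (fun i => hF.expand r i (sel i)) hΛ0 (fun i => (hrow i).le)
  have hlow : (q : ℝ) * ((1 - ε) * a) ≤ ∑ i, (star (v i) ⬝ᵥ (E.effect A *ᵥ v i)).re := by
    have h := Finset.card_nsmul_le_sum Finset.univ (fun i => (star (v i) ⬝ᵥ (E.effect A *ᵥ v i)).re)
      ((1 - ε) * a) (fun i _ => by
        have h1 := hsel i
        unfold POVM.AlmostCertain at h1
        rw [hF.re_self] at h1
        exact h1)
    rwa [Finset.card_univ, hF.cardI, nsmul_eq_mul] at h
  have ha0 : a ≠ 0 := hF.apos.ne'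
  have hq0 : (q : ℝ) ≠ 0 := hqr.ne'
  have hΛa : (a + ((q : ℝ) - 1) * (a / q)) / a = (2 * q - 1) / q := by
    field_simp
    ring
  rw [hΛa] at hG
  have key : (q : ℝ) * ((1 - ε) * a) ≤ (2 * q - 1) / q * ∑ j, (E.weight (z r j) A).re := hlow.trans hG
  have := mul_le_mul_of_nonneg_left key hqr.le
  calc (q : ℝ) ^ 2 * ((1 - ε) * a) = q * (q * ((1 - ε) * a)) := by ring
    _ ≤ q * ((2 * q - 1) / q * ∑ j, (E.weight (z r j) A).re) := this
    _ = (2 * q - 1) * ∑ j, (E.weight (z r j) A).re := by field_simp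

omit [DecidableEq I] in
/-- **At least six `A`-high vectors in every family** (`q ≥ 13`, `ε(q² + 1) < 1`): the Gram step from below
against the trace bound from above. [folklore] -/
theorem six_le_card (hF : MUBFrames q a z) (hq : 13 ≤ q) (E : POVM X κ) {ε : ℝ}
    (hε : ε * ((q : ℝ) ^ 2 + 1) < 1) (hE : ∀ i j, ∃ k, E.AlmostCertain ε (z i j) k) {A : κ}
    (hall : ∀ s, ∃ j, E.AlmostCertain ε (z s j) A) (s : I)
    (W : Finset J) (hW : ∀ j, j ∈ W ↔ E.AlmostCertain ε (z s j) A) : 6 ≤ W.card := by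
  by_contra hlt
  push Not at hlt
  have h5 : (W.card : ℝ) ≤ 5 := by exact_mod_cast Nat.lt_succ_iff.1 hlt
  obtain ⟨j₀, hj₀⟩ := hall s
  have hε0 : 0 ≤ ε := hF.eps_nonneg E hj₀
  have ha := hF.apos
  have hup := hF.trace_le E (hE s) W hW
  have hdown := hF.trace_ge_gram E hall s
  set T := ∑ j, (E.weight (z s j) A).re with hT
  have hq' : (13 : ℝ) ≤ q := by exact_mod_cast hq
  have hεq : ε * (q : ℝ) ^ 2 ≤ 1 - ε := by nlinarith
  have h1 : T ≤ 6 * ((1 - ε) * a) := by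
    have : (W.card : ℝ) * a + ((q : ℝ) ^ 2 - W.card) * (ε * a)
        = W.card * ((1 - ε) * a) + ε * (q : ℝ) ^ 2 * a := by ring
    rw [this] at hup
    have h1ε : 0 ≤ (1 - ε) * a := by nlinarith
    nlinarith [mul_le_mul_of_nonneg_right h5 h1ε, mul_le_mul_of_nonneg_right hεq ha.le]
  have h2 : (q : ℝ) ^ 2 * ((1 - ε) * a) ≤ (6 * (2 * q - 1)) * ((1 - ε) * a) := by nlinarith
  have hpos : 0 < (1 - ε) * a := by nlinarith
  have h3 : (q : ℝ) ^ 2 ≤ 6 * (2 * q - 1) := le_of_mul_le_mul_right h2 hpos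
  nlinarith

omit [DecidableEq I] in
/-- **The block inequality.**  Reference family `r` with `A`-high set `W` (`h := #W`), another family
`s ≠ r` with `A`-high set `F`: every `u ∈ F` splits as `P_W u + P_{Wᶜ} u` with `‖P_W u‖² = h·a/q²`, the
`A`-weights of the `P_{Wᶜ} u` (`u` over ALL of family `s`) sum to `Σ_{j ∉ W}⟨z_{r,j}|E_A|z_{r,j}⟩ ≤ (q² − h)εa`
(trace identity), and AM–GM (`t = 2/5`) gives `#F·(1 − ε)a ≤ #F·(7/5)·h·a/q² + (7/2)(q² − h)εa`.
[folklore] [cite: NielsenChuang2010, Box 2.3 p. 87, §2.2.6 p. 90] -/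
theorem block_ineq (hF : MUBFrames q a z) (E : POVM X κ) {ε : ℝ}
    (hE : ∀ i j, ∃ k, E.AlmostCertain ε (z i j) k) {A : κ} {r s : I} (hrs : r ≠ s)
    (W : Finset J) (hW : ∀ j, j ∈ W ↔ E.AlmostCertain ε (z r j) A)
    (F : Finset J) (hFs : ∀ j, j ∈ F ↔ E.AlmostCertain ε (z s j) A) :
    (F.card : ℝ) * ((1 - ε) * a)
      ≤ F.card * (7 / 5 * (W.card * a / (q : ℝ) ^ 2)) + 7 / 2 * (((q : ℝ) ^ 2 - W.card) * (ε * a)) := by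
  classical
  have ha := hF.apos
  have hqr : (0 : ℝ) < q := by exact_mod_cast hF.qpos
  -- the two sub-frames of family `r`
  set O₁ : {j // j ∈ W} → X → ℂ := fun j => z r j.1 with hO₁
  set O₂ : {j // ¬ j ∈ W} → X → ℂ := fun j => z r j.1 with hO₂
  have hO₁o : ∀ j j' : {j // j ∈ W}, star (O₁ j) ⬝ᵥ O₁ j' = if j = j' then ((a : ℂ)) else 0 := by
    intro j j'
    by_cases hjj : j = j'
    · subst hjj; rw [if_pos rfl, hO₁, hF.orth, if_pos rfl]
    · rw [if_neg hjj, hO₁, hF.orth, if_neg (fun h => hjj (Subtype.ext h))]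
  have hO₂o : ∀ j j' : {j // ¬ j ∈ W}, star (O₂ j) ⬝ᵥ O₂ j' = if j = j' then ((a : ℂ)) else 0 := by
    intro j j'
    by_cases hjj : j = j'
    · subst hjj; rw [if_pos rfl, hO₂, hF.orth, if_pos rfl]
    · rw [if_neg hjj, hO₂, hF.orth, if_neg (fun h => hjj (Subtype.ext h))]
  have hsplit : ∀ u : X → ℂ, frameProj (z r) a u = frameProj O₁ a u + frameProj O₂ a u := fun u => by
    rw [hO₁, hO₂]
    convert frameProj_eq_add_subtype (z r) a (fun j => j ∈ W) u using 3
  -- cardinalities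
  have hc₁ : Fintype.card {j // j ∈ W} = W.card := Fintype.card_coe W
  have hc₂ : (Fintype.card {j // ¬ j ∈ W} : ℝ) = (q : ℝ) ^ 2 - W.card := by
    rw [Fintype.card_subtype_compl, Fintype.card_coe, hF.cardJ, Nat.cast_sub, Nat.cast_pow]
    rw [← hF.cardJ, ← Fintype.card_coe W]
    exact Fintype.card_subtype_le _
  -- `‖P₁ u‖² = h a / q²` for `u` in family `s`
  have hP₁n : ∀ j', (star (frameProj O₁ a (z s j')) ⬝ᵥ frameProj O₁ a (z s j')).re
      = W.card * a / (q : ℝ) ^ 2 := by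
    intro j'
    rw [star_frameProj_self O₁ ha hO₁o, Complex.ofReal_re]
    have : ∀ j : {j // j ∈ W}, ‖star (O₁ j) ⬝ᵥ z s j'‖ ^ 2 = (a / q) ^ 2 := fun j =>
      hF.mub r s hrs j.1 j'
    simp_rw [this]
    rw [Finset.sum_const, Finset.card_univ, hc₁, nsmul_eq_mul]
    have ha0 : a ≠ 0 := ha.ne'
    have hq0 : (q : ℝ) ≠ 0 := hqr.ne'
    field_simp
  -- the defect terms and their total
  set D : J → ℝ := fun j' =>
    (star (frameProj O₂ a (z s j')) ⬝ᵥ (E.effect A *ᵥ frameProj O₂ a (z s j'))).re with hD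
  have hD0 : ∀ j', 0 ≤ D j' := fun j' =>
    (Complex.nonneg_iff.1 ((E.posSemidef A).dotProduct_mulVec_nonneg _)).1
  have hDsum : ∑ j', D j' ≤ ((q : ℝ) ^ 2 - W.card) * (ε * a) := by
    have hid := sum_star_frameProj_mulVec O₂ (z s) ha hO₂o (fun j => hF.expand s r j.1) (E.effect A)
    have hre : ∑ j', D j' = ∑ j : {j // ¬ j ∈ W}, (E.weight (O₂ j) A).re := by
      simp only [hD, POVM.weight]
      rw [← Complex.re_sum, ← Complex.re_sum, ← hid]
    rw [hre]
    have := Finset.card_nsmul_le_sum Finset.univ (fun j : {j // ¬ j ∈ W} => -(E.weight (O₂ j) A).re)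
      (-(ε * a)) (fun j _ => neg_le_neg (hF.weight_re_le_of_not_ac E (hE r j.1)
        (fun h => j.2 ((hW j.1).2 h))))
    rw [Finset.card_univ, nsmul_eq_mul, hc₂, Finset.sum_neg_distrib] at this
    linarith
  -- the per-vector inequality for `A`-high `u` in family `s`
  have hper : ∀ j' ∈ F, (1 - ε) * a ≤ 7 / 5 * (W.card * a / (q : ℝ) ^ 2) + 7 / 2 * D j' := by
    intro j' hj'
    have hac := (hFs j').1 hj'
    unfold POVM.AlmostCertain at hac
    rw [hF.re_self] at hac
    have hu : frameProj O₁ a (z s j') + frameProj O₂ a (z s j') = z s j' := by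
      rw [← hsplit, ← hF.expand r s j']
    have hw : E.weight (z s j') A = star (frameProj O₁ a (z s j') + frameProj O₂ a (z s j'))
        ⬝ᵥ (E.effect A *ᵥ (frameProj O₁ a (z s j') + frameProj O₂ a (z s j'))) := by
      rw [hu]; rfl
    have ham := re_quadForm_add_le (E.posSemidef A) (frameProj O₁ a (z s j')) (frameProj O₂ a (z s j'))
      (t := 2 / 5) (by norm_num)
    rw [← hw] at ham
    have hP₁w : (star (frameProj O₁ a (z s j')) ⬝ᵥ (E.effect A *ᵥ frameProj O₁ a (z s j'))).re
        ≤ W.card * a / (q : ℝ) ^ 2 := by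
      rw [← hP₁n j']
      exact E.weight_re_le (frameProj O₁ a (z s j')) A
    have h75 : (1 : ℝ) + 2 / 5 = 7 / 5 := by norm_num
    have h72 : (1 : ℝ) + 1 / (2 / 5) = 7 / 2 := by norm_num
    rw [h75, h72] at ham
    have := hD0 j'
    nlinarith
  -- sum over `F`
  have hsumF := Finset.card_nsmul_le_sum F (fun j' => 7 / 5 * (W.card * a / (q : ℝ) ^ 2) + 7 / 2 * D j')
    ((1 - ε) * a) hper
  rw [nsmul_eq_mul, Finset.sum_add_distrib, Finset.sum_const, nsmul_eq_mul, ← Finset.mul_sum] at hsumF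
  have hFD : ∑ j' ∈ F, D j' ≤ ∑ j', D j' := Finset.sum_le_univ_sum_of_nonneg hD0
  nlinarith [hDsum, hFD]

omit [DecidableEq I] in
/-- **More than half of every family is `A`-high** (`q ≥ 13`, `ε(q² + 1) < 1`, one `A`-high vector
anywhere): the block inequality with `#F ≥ 6`, `εq² < 1 − ε`, against `h ≤ q²/2`. [folklore] -/
theorem half_lt_card (hF : MUBFrames q a z) (hq : 13 ≤ q) (E : POVM X κ) {ε : ℝ}
    (hε : ε * ((q : ℝ) ^ 2 + 1) < 1) (hE : ∀ i j, ∃ k, E.AlmostCertain ε (z i j) k) {A : κ} {i₀ : I}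
    {j₀ : J} (hA : E.AlmostCertain ε (z i₀ j₀) A) (r : I)
    (W : Finset J) (hW : ∀ j, j ∈ W ↔ E.AlmostCertain ε (z r j) A) : (q : ℝ) ^ 2 < 2 * W.card := by
  classical
  have hε0 : 0 ≤ ε := hF.eps_nonneg E hA
  have ha := hF.apos
  have hq' : (13 : ℝ) ≤ q := by exact_mod_cast hq
  have hall := hF.exists_ac E hε hE hA
  -- another family
  have hcard : 1 < Fintype.card I := by rw [hF.cardI]; omega
  obtain ⟨s, hs⟩ := Fintype.exists_ne_of_one_lt_card hcard r
  set F : Finset J := Finset.univ.filter fun j => E.AlmostCertain ε (z s j) A with hFd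
  have hFs : ∀ j, j ∈ F ↔ E.AlmostCertain ε (z s j) A := fun j => by simp [hFd]
  have h6 : (6 : ℝ) ≤ F.card := by exact_mod_cast hF.six_le_card hq E hε hE hall s F hFs
  have hblk := hF.block_ineq E hE (Ne.symm hs) W hW F hFs
  by_contra hle
  push Not at hle
  set h : ℝ := (W.card : ℝ) with hh
  set hs' : ℝ := (F.card : ℝ) with hhs
  set Qs : ℝ := (q : ℝ) ^ 2 with hQs
  have hQs : 0 < Qs := by positivity
  have hεq : ε * Qs ≤ 1 - ε := by nlinarith
  have hh0 : 0 ≤ h := by positivity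
  -- divide the block inequality by `a` and multiply by `Qs`
  have h1 : hs' * (1 - ε) * Qs ≤ 7 / 5 * hs' * h + 7 / 2 * ((Qs - h) * (ε * Qs)) := by
    have e1 : hs' * (7 / 5 * (h * a / Qs)) = (7 / 5 * hs' * h / Qs) * a := by ring
    have e2 : 7 / 2 * ((Qs - h) * (ε * a)) = (7 / 2 * ((Qs - h) * ε)) * a := by ring
    rw [e1, e2, ← add_mul, show hs' * ((1 - ε) * a) = (hs' * (1 - ε)) * a by ring] at hblk
    have h1' : hs' * (1 - ε) ≤ 7 / 5 * hs' * h / Qs + 7 / 2 * ((Qs - h) * ε) := le_of_mul_le_mul_right hblk ha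
    have := mul_le_mul_of_nonneg_right h1' hQs.le
    rw [add_mul] at this
    have e3 : 7 / 5 * hs' * h / Qs * Qs = 7 / 5 * hs' * h := by field_simp
    rw [e3] at this
    linarith
  have h2 : (Qs - h) * (ε * Qs) ≤ (Qs - h) * (1 - ε) := mul_le_mul_of_nonneg_left hεq (by linarith)
  have h3 : 7 / 5 * hs' * h - 7 / 2 * (h * (1 - ε)) ≤ (7 / 5 * hs' - 7 / 2 * (1 - ε)) * (Qs / 2) := by
    have hc : 0 ≤ 7 / 5 * hs' - 7 / 2 * (1 - ε) := by nlinarith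
    have := mul_le_mul_of_nonneg_left (show h ≤ Qs / 2 by linarith) hc
    nlinarith
  have h4 : hs' * (1 - ε) * Qs ≤ (7 / 10 * hs' + 7 / 4 * (1 - ε)) * Qs := by nlinarith
  have h5 : hs' * (1 - ε) ≤ 7 / 10 * hs' + 7 / 4 * (1 - ε) := le_of_mul_le_mul_right h4 hQs
  have h6' : 6 * (3 / 10 - ε) ≤ hs' * (3 / 10 - ε) := mul_le_mul_of_nonneg_right h6 (by nlinarith)
  nlinarith

omit [DecidableEq I] in
/-- **Constancy below `1/(q² + 1)`.**  For `q ≥ 13` mutually unbiased orthogonal frames of size `q²` and a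
general measurement that is `ε`-almost sure on every frame vector with `ε·(q² + 1) < 1`, ALL frame vectors
have one and the same almost-certain outcome: two different outcomes would each be almost certain on more
than half of one family.  Sharp: at `ε = 1/(q² + 1)` the sub-normalised rank-one measurement
`{(1 − ε)|z⟩⟨z|/a, 1 − (1 − ε)|z⟩⟨z|/a}` along one frame vector is `ε`-almost sure on all of them and is not
constant. [folklore] [cite: NielsenChuang2010, §2.2.6 p. 90, Box 2.3 p. 87] -/
theorem sameOutcome (hF : MUBFrames q a z) (hq : 13 ≤ q) (E : POVM X κ) {ε : ℝ}
    (hε : ε * ((q : ℝ) ^ 2 + 1) < 1) (hE : ∀ i j, ∃ k, E.AlmostCertain ε (z i j) k)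
    {i i' : I} {j j' : J} {k k' : κ} (hk : E.AlmostCertain ε (z i j) k)
    (hk' : E.AlmostCertain ε (z i' j') k') : k = k' := by
  classical
  by_contra hkk
  have hε0 : 0 ≤ ε := hF.eps_nonneg E hk
  have hq' : (13 : ℝ) ≤ q := by exact_mod_cast hq
  have hε2 : ε < 1 / 2 := by nlinarith
  set W : Finset J := Finset.univ.filter fun j => E.AlmostCertain ε (z i j) k with hWd
  set W' : Finset J := Finset.univ.filter fun j => E.AlmostCertain ε (z i j) k' with hW'd
  have hW : ∀ j, j ∈ W ↔ E.AlmostCertain ε (z i j) k := fun j => by simp [hWd]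
  have hW' : ∀ j, j ∈ W' ↔ E.AlmostCertain ε (z i j) k' := fun j => by simp [hW'd]
  have h1 := hF.half_lt_card hq E hε hE hk i W hW
  have h2 := hF.half_lt_card hq E hε hE hk' i W' hW'
  have hdisj : Disjoint W W' := by
    rw [Finset.disjoint_left]
    intro j hj hj'
    exact hkk (E.almostCertain_unique hε2 (hF.ne_zero i j) ((hW j).1 hj) ((hW' j).1 hj'))
  have hcard : W.card + W'.card ≤ q ^ 2 := by
    rw [← Finset.card_union_of_disjoint hdisj, ← hF.cardJ, ← Finset.card_univ]
    exact Finset.card_le_univ _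
  have : ((W.card + W'.card : ℕ) : ℝ) ≤ ((q ^ 2 : ℕ) : ℝ) := by exact_mod_cast hcard
  push_cast at this
  linarith

end MUBFrames

end MUB

/-! ## Part IV.  The slope block at one unknown coordinate: `Q` mutually unbiased frames of size `Q²` -/

namespace Shape

variable (S : Shape)

/-- The class member with dummy slope `g·e_τ` in straightened coordinates:
`B^τ_{g; x, w} := |u_{g·e_τ; x, w − x·b̄}⟩` (`g = 0` is `Z_{x,w}`, `g = G′` the test vector `u^τ_{G′; x, w}`).
[cite: ChenQuantumLattice2024, §3.1 p. 22, eq. (35) p. 31] -/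
noncomputable def bKet (τ : Fin S.n) (g x : ZMod S.Q) (w : Fin S.n → ZMod S.Q) :
    (Fin (S.n + 1) → ZMod S.M) → ℂ :=
  S.uKet (Pi.single τ g) x (w - x • S.bbar)

/-- `Z_{x,w} = B^τ_{0; x, w}`. [cite: ChenQuantumLattice2024, eq. (35) p. 31] -/
theorem zKet_eq_bKet (τ : Fin S.n) (x : ZMod S.Q) (w : Fin S.n → ZMod S.Q) :
    S.zKet x w = S.bKet τ 0 x w := by
  rw [bKet, Pi.single_zero]
  rfl

/-- `u^τ_{G′; x, w} = B^τ_{G′; x, w}`. [cite: ChenQuantumLattice2024, eq. (35) p. 31] -/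
theorem tKet_eq_bKet (τ : Fin S.n) (G' : ℕ) (x : ZMod S.Q) (w : Fin S.n → ZMod S.Q) :
    S.tKet τ G' x w = S.bKet τ ((G' : ℕ) : ZMod S.Q) x w := rfl

/-- One slope family is orthogonal of norm² `ν/Qⁿ`. [folklore] -/
theorem star_bKet_dotProduct_bKet (h : S.Admissible) (τ : Fin S.n) (g x x' : ZMod S.Q)
    (w w' : Fin S.n → ZMod S.Q) :
    star (S.bKet τ g x w) ⬝ᵥ S.bKet τ g x' w'
      = if x = x' ∧ w = w' then (((S.frameNormSq / ((S.Q : ℕ) : ℝ) ^ S.n : ℝ)) : ℂ) else 0 := by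
  unfold bKet
  rw [S.star_uKet_dotProduct_uKet_same h]
  by_cases hx : x = x'
  · subst hx
    by_cases hw : w = w'
    · subst hw; rw [if_pos ⟨rfl, rfl⟩, if_pos ⟨rfl, rfl⟩]
    · rw [if_neg, if_neg (fun h' => hw h'.2)]
      rintro ⟨-, h2⟩
      exact hw (sub_left_injective h2)
  · rw [if_neg (fun h' => hx h'.1), if_neg (fun h' => hx h'.1)]

/-- **Unit slopes see the same as slope `1`:** for `G′` a unit mod `Q`,
`‖⟨Z_{x,w}|u^τ_{G′; x′, w′}⟩‖ = ‖⟨Z_{x,w}|u^τ_{1; x″, w′}⟩‖` with `x − x″ = (x − x′)·G′⁻¹` (the contributing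
blocks `η_τ G′ = x − x′` are the blocks `η_τ = x − x″`). [cite: ChenQuantumLattice2024, eq. (35) p. 31, §3.5.8 p. 34] -/
theorem norm_zKet_tKet_of_isUnit (h : S.Admissible) (τ : Fin S.n) {G' : ℕ}
    (hu : IsUnit ((G' : ℕ) : ZMod S.Q)) (x x' : ZMod S.Q) (w w' : Fin S.n → ZMod S.Q) :
    ‖star (S.zKet x w) ⬝ᵥ S.tKet τ G' x' w'‖
      = ‖star (S.zKet x w) ⬝ᵥ S.tKet τ 1 (x - (x - x') * (↑(hu.unit⁻¹) : ZMod S.Q)) w'‖ := by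
  have hψ : ∀ a : ZMod S.Q, ‖(ZMod.stdAddChar a : ℂ)‖ = 1 := fun a => by
    rw [ZMod.stdAddChar_apply, Circle.norm_coe]
  rw [S.star_zKet_dotProduct_tKet h, S.star_zKet_dotProduct_tKet h]
  have hsum : ∑ η : Fin S.n → ZMod S.Q, (if η τ * (G' : ZMod S.Q) = x - x'
        then (ZMod.stdAddChar (∑ t, η t * (w - w') t) : ℂ) else 0)
      = ∑ η : Fin S.n → ZMod S.Q, (if η τ * ((1 : ℕ) : ZMod S.Q) = x - (x - (x - x') * ↑(hu.unit⁻¹))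
        then (ZMod.stdAddChar (∑ t, η t * (w - w') t) : ℂ) else 0) := by
    refine Finset.sum_congr rfl fun η _ => ?_
    have hiff : η τ * (G' : ZMod S.Q) = x - x'
        ↔ η τ * ((1 : ℕ) : ZMod S.Q) = x - (x - (x - x') * ↑(hu.unit⁻¹)) := by
      rw [Nat.cast_one, mul_one, sub_sub_cancel]
      constructor
      · intro he
        rw [← he, mul_assoc, IsUnit.mul_val_inv, mul_one]
      · intro he
        rw [he, mul_assoc, IsUnit.val_inv_mul, mul_one]
    by_cases hc : η τ * (G' : ZMod S.Q) = x - x'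
    · rw [if_pos hc, if_pos (hiff.1 hc)]
    · rw [if_neg hc, if_neg (fun h' => hc (hiff.2 h'))]
  rw [hsum]
  simp only [norm_mul, hψ]

/-- **The unit-slope overlap formula:** for `G′` a unit mod `Q`,
`‖⟨Z_{x,w}|u^τ_{G′; x′, w′}⟩‖² = (ν/Qⁿ/Q)²·[w_t = w′_t for t ≠ τ]` — EVERY straightened member sees EVERY test
vector with the same unknown-free tail, with the minimal possible weight: the two frames are mutually
unbiased on each `(x, w_τ)`-block. [cite: ChenQuantumLattice2024, eq. (35) p. 31, §3.5.8 pp. 33–34] -/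
theorem normSq_zKet_tKet_of_isUnit (h : S.Admissible) (τ : Fin S.n) {G' : ℕ}
    (hu : IsUnit ((G' : ℕ) : ZMod S.Q)) (x x' : ZMod S.Q) (w w' : Fin S.n → ZMod S.Q) :
    ‖star (S.zKet x w) ⬝ᵥ S.tKet τ G' x' w'‖ ^ 2
      = if (∀ t, t ≠ τ → w t = w' t) then (S.frameNormSq / ((S.Q : ℕ) : ℝ) ^ S.n / (S.Q : ℕ)) ^ 2
        else 0 := by
  rw [S.norm_zKet_tKet_of_isUnit h τ hu,
    S.normSq_zKet_tKet h (G' := 1) (H' := (S.Q : ℕ)) (one_mul _).symm τ]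
  have hc : ((((S.Q : ℕ) : ℕ) : ZMod S.Q) * (x - (x - (x - x') * ↑(hu.unit⁻¹))) = 0
        ∧ ∀ t, ((spike τ (S.Q : ℕ) t : ℕ) : ZMod S.Q) * (w t - w' t) = 0)
      ↔ ∀ t, t ≠ τ → w t = w' t := by
    constructor
    · rintro ⟨-, hsp⟩ t ht
      have := hsp t
      rwa [spike_of_ne _ ht, Nat.cast_one, one_mul, sub_eq_zero] at this
    · intro hw
      refine ⟨by rw [ZMod.natCast_self, zero_mul], fun t => ?_⟩
      by_cases ht : t = τ
      · subst ht
        rw [spike_self, ZMod.natCast_self, zero_mul]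
      · rw [spike_of_ne _ ht, Nat.cast_one, one_mul, sub_eq_zero]
        exact hw t ht
  by_cases hw : ∀ t, t ≠ τ → w t = w' t
  · rw [if_pos (hc.2 hw), if_pos hw]
  · rw [if_neg (fun h' => hw (hc.1 h')), if_neg hw]

/-- Re-sloping does not change the frame normalisation `ν`. [folklore] -/
theorem frameNormSq_reslope (γ : Fin S.n → ZMod S.Q) : (S.reslope γ).frameNormSq = S.frameNormSq := rfl

/-- **Two slope families at `τ` with unit slope difference are mutually unbiased on each tail class:**
`‖⟨B^τ_{g; x, w}|B^τ_{g′; x′, w′}⟩‖² = (ν/Qⁿ/Q)²·[w_t = w′_t for t ≠ τ]` whenever `g′ − g` is a unit mod `Q`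
(re-slope by `g·e_τ`, then the unit-slope overlap formula). [cite: ChenQuantumLattice2024, eq. (35) p. 31, §3.1 p. 22] -/
theorem normSq_bKet_bKet_of_isUnit (h : S.Admissible) (τ : Fin S.n) {g g' : ZMod S.Q}
    (hu : IsUnit (g' - g)) (x x' : ZMod S.Q) (w w' : Fin S.n → ZMod S.Q) :
    ‖star (S.bKet τ g x w) ⬝ᵥ S.bKet τ g' x' w'‖ ^ 2
      = if (∀ t, t ≠ τ → w t = w' t) then (S.frameNormSq / ((S.Q : ℕ) : ℝ) ^ S.n / (S.Q : ℕ)) ^ 2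
        else 0 := by
  set γ : Fin S.n → ZMod S.Q := Pi.single τ g with hγ
  have h' : (S.reslope γ).Admissible := S.reslope_admissible h γ
  set W : Fin S.n → ZMod S.Q := w - x • S.bbar + x • (S.reslope γ).bbar with hW
  set W' : Fin S.n → ZMod S.Q := w' - x' • S.bbar + x' • (S.reslope γ).bbar with hW'
  have hL : S.bKet τ g x w = (S.reslope γ).zKet x W := by
    unfold bKet
    exact S.uKet_eq_reslope_zKet γ x _
  have hR : S.bKet τ g' x' w' = (S.reslope γ).tKet τ (g' - g).val x' W' := by
    unfold bKet
    have e : (Pi.single τ g' : Fin S.n → ZMod S.Q)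
        = γ + Pi.single τ ((((g' - g).val : ℕ)) : ZMod S.Q) := by
      rw [ZMod.natCast_zmod_val, hγ, ← Pi.single_add, add_sub_cancel]
    rw [e, ← S.uKet_reslope]
    show _ = (S.reslope γ).uKet _ x' (W' - x' • (S.reslope γ).bbar)
    rw [hW', add_sub_cancel_right]
  have hu' : IsUnit ((((g' - g).val : ℕ)) : ZMod S.Q) := by
    rw [ZMod.natCast_zmod_val]; exact hu
  have key := (S.reslope γ).normSq_zKet_tKet_of_isUnit h' τ hu' x x' W W'
  rw [hL, hR]
  refine key.trans ?_
  have hoff : ∀ t, t ≠ τ → (W t = W' t ↔ w t = w' t) := by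
    intro t ht
    have hγt : γ t = 0 := by rw [hγ, Pi.single_eq_of_ne ht]
    have hWt : W t = w t := by
      rw [hW, Pi.add_apply, Pi.sub_apply, Pi.smul_apply, Pi.smul_apply, smul_eq_mul, smul_eq_mul,
        S.bbar_reslope h γ t, hγt, mul_zero, add_zero, sub_add_cancel]
    have hW't : W' t = w' t := by
      rw [hW', Pi.add_apply, Pi.sub_apply, Pi.smul_apply, Pi.smul_apply, smul_eq_mul, smul_eq_mul,
        S.bbar_reslope h γ t, hγt, mul_zero, add_zero, sub_add_cancel]
    rw [hWt, hW't]
  have hcond : (∀ t, t ≠ τ → W t = W' t) ↔ ∀ t, t ≠ τ → w t = w' t :=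
    ⟨fun H t ht => (hoff t ht).1 (H t ht), fun H t ht => (hoff t ht).2 (H t ht)⟩
  by_cases hw : ∀ t, t ≠ τ → w t = w' t
  · rw [if_pos hw]
    exact if_pos (hcond.2 hw)
  · rw [if_neg hw]
    exact if_neg (fun H => hw (hcond.1 H))

/-- **The slope block is a system of `Q` mutually unbiased orthogonal frames of size `Q²`** (prime `Q`):
family `g ∈ ℤ_Q` = the members `B^τ_{g; x, w}` with `w = w⁰` off `τ`, indexed by `(x, w_τ) ∈ ℤ_Q²`; each
family orthogonal of norm² `ν/Qⁿ`, two families mutually unbiased with overlap² `(ν/Qⁿ/Q)²`.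
[cite: ChenQuantumLattice2024, eq. (35) p. 31, §3.5.8 pp. 33–34; NielsenChuang2010, Box 2.3 p. 87] -/
theorem slopeBlock (h : S.Admissible) (hQ : (S.Q : ℕ).Prime) (τ : Fin S.n) (w₀ : Fin S.n → ZMod S.Q) :
    MUBFrames (S.Q : ℕ) (S.frameNormSq / ((S.Q : ℕ) : ℝ) ^ S.n)
      (fun (g : ZMod S.Q) (v : ZMod S.Q × ZMod S.Q) => S.bKet τ g v.1 (Function.update w₀ τ v.2)) where
  apos := S.frameNormSq_div_pos
  qpos := S.Q.pos
  cardI := ZMod.card _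
  cardJ := by rw [Fintype.card_prod, ZMod.card, sq]
  orth := fun g v v' => by
    rw [S.star_bKet_dotProduct_bKet h]
    by_cases hv : v = v'
    · subst hv; rw [if_pos ⟨rfl, rfl⟩, if_pos rfl]
    · rw [if_neg, if_neg hv]
      rintro ⟨h1, h2⟩
      apply hv
      refine Prod.ext h1 ?_
      have := congrFun h2 τ
      rwa [Function.update_self, Function.update_self] at this
  mub := fun g g' hg v v' => by
    haveI : Fact (Nat.Prime (S.Q : ℕ)) := ⟨hQ⟩
    have hu : IsUnit (g' - g) := IsUnit.mk0 _ (sub_ne_zero.2 (Ne.symm hg))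
    rw [S.normSq_bKet_bKet_of_isUnit h τ hu, if_pos]
    intro t ht
    rw [Function.update_of_ne ht, Function.update_of_ne ht]

end Shape

/-! ## Part V.  The theorem: the Step-8 ceiling for prime `Q ≥ 13` holds for every `ε < 1/(Q² + 1)` -/

namespace Shape

variable (S : Shape)

/-- **The exact Step-8 measurement ceiling for prime `Q ≥ 13`.**  If a general measurement (POVM) of the
Step-8 register is `ε`-almost sure on the Karst-wave class `InClass U` of `S` with at least one unknown
tail coordinate (`t₁+1 ∈ U`), `Q` is a prime `≥ 13`, and `ε·(Q² + 1) < 1`, then `|φ7.d⟩` of `S` and of the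
shifted instance `(b, v′ + 2D²p₁b)` — whose Step-9 requirements differ — get THE SAME almost-certain outcome.
With `Shape.step8_povm_ceiling_fails_at_threshold` (failure AT `ε = 1/(minFac(Q)² + 1)` for every
admissible `Q`) the tolerance threshold of Chen's Step 8 for prime `Q ≥ 13` is EXACTLY `1/(Q² + 1)`: the
window `[1/(4Q²), 1/Q²]` of (Q) `Shape.step8_povm_ceiling_order_prime` and its open factor `4` are closed.
Proof: the `Q` dummy-slope families `g·e_{t₁}` of the base class, restricted to one `(x, w_{t₁})`-block, are
`Q` mutually unbiased orthogonal bases of a `Q²`-dimensional space (`Shape.slopeBlock`) containing both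
states in family `0`; `MUBFrames.sameOutcome`.  HONEST FRAMING: a theorem about the measurement step of a
WITHDRAWN algorithm (Chen, ePrint 2024/555, Step 9 retracted 2024-04-18) — it says exactly how insensitive
Step 8's failure is to approximate measurement; it repairs nothing, breaks nothing, and is not progress on
any lattice problem. [cite: ChenQuantumLattice2024, Lemma 3.13 pp. 32–34, eq. (35) p. 31, §3.5.8 pp. 33–34;
NielsenChuang2010, §2.2.6 p. 90, Box 2.3 p. 87] -/
theorem step8_povm_ceiling_prime (h : S.Admissible) (hQ : (S.Q : ℕ).Prime) (h13 : 13 ≤ (S.Q : ℕ))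
    {κ : Type*} [Fintype κ] [DecidableEq κ]
    (U : Finset (Fin (S.n + 1))) (t₁ : Fin S.n) (ht₁ : t₁.succ ∈ U)
    (E : POVM (Fin (S.n + 1) → ZMod S.M) κ) {ε : ℝ}
    (hε : ε * (((S.Q : ℕ) : ℝ) ^ 2 + 1) < 1) (hE : S.AlmostSureOn ε U E)
    {k k' : κ} (hk : E.AlmostCertain ε S.phi7d k)
    (hk' : E.AlmostCertain ε (S.inst S.b (fun i => S.v' i + 2 * (S.D : ℤ) * S.D * S.p₁ * S.b i)).phi7d k') :
    k = k' := by
  classical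
  obtain ⟨c₀, x₀, y₀, hφS, hφS'⟩ : ∃ (c₀ : S.Coset) (x₀ : ZMod S.Q) (y₀ : Fin S.n → ZMod S.Q),
      S.phi7d = (S.cshape c₀).uKet 0 x₀ y₀
      ∧ (S.inst S.b (fun i => S.v' i + 2 * (S.D : ℤ) * S.D * S.p₁ * S.b i)).phi7d
          = (S.cshape c₀).uKet 0 (x₀ - 1) (fun t => y₀ t + ((S.b t.succ : ℤ) : ZMod S.Q)) :=
    ⟨_, _, _, S.phi7d_eq_uKet h, S.phi7d_shift_eq_uKet h⟩
  have h₀ : (S.cshape c₀).Admissible := S.cshape_admissible h c₀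
  have hE₀ : (S.cshape c₀).AlmostSureOn ε U E := fun b₂ v₂ hI => hE b₂ v₂ hI
  -- the two states as straightened members `Z_{x₀, w₀}` and `Z_{x₀ − 1, w₀}`
  set w₀ : Fin S.n → ZMod S.Q := y₀ + x₀ • (S.cshape c₀).bbar with hw₀
  have hz₁ : (S.cshape c₀).zKet x₀ w₀ = S.phi7d := by
    rw [hφS, Shape.zKet, hw₀, add_sub_cancel_right]
  have hz₂ : (S.cshape c₀).zKet (x₀ - 1) w₀
      = (S.inst S.b (fun i => S.v' i + 2 * (S.D : ℤ) * S.D * S.p₁ * S.b i)).phi7d := by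
    rw [hφS', Shape.zKet, hw₀]
    congr 1
    funext t
    rw [Pi.sub_apply, Pi.add_apply, Pi.smul_apply, Pi.smul_apply, smul_eq_mul, smul_eq_mul,
      show (S.cshape c₀).bbar t = ((S.b t.succ : ℤ) : ZMod S.Q) from rfl]
    ring
  -- the slope block at `t₁` through `w₀`
  have hF := (S.cshape c₀).slopeBlock h₀ hQ t₁ w₀
  have hTU : ∀ t ∈ ({t₁} : Finset (Fin S.n)), t.succ ∈ U := fun t ht => by
    rw [Finset.mem_singleton.1 ht]; exact ht₁
  have hEz : ∀ (g : ZMod S.Q) (v : ZMod S.Q × ZMod S.Q),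
      ∃ k, E.AlmostCertain ε ((S.cshape c₀).bKet t₁ g v.1 (Function.update w₀ t₁ v.2)) k := by
    intro g v
    unfold Shape.bKet
    exact (S.cshape c₀).exists_almostCertain_uKet h₀ hTU hE₀ _ _ _
      (fun t ht => by rw [Pi.single_eq_of_ne (fun h' => ht (Finset.mem_singleton.2 h'))])
  have e₁ : S.phi7d = (S.cshape c₀).bKet t₁ 0 (x₀, w₀ t₁).1 (Function.update w₀ t₁ (x₀, w₀ t₁).2) := by
    rw [Function.update_eq_self, ← Shape.zKet_eq_bKet, hz₁]
  have e₂ : (S.inst S.b (fun i => S.v' i + 2 * (S.D : ℤ) * S.D * S.p₁ * S.b i)).phi7d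
      = (S.cshape c₀).bKet t₁ 0 (x₀ - 1, w₀ t₁).1 (Function.update w₀ t₁ (x₀ - 1, w₀ t₁).2) := by
    rw [Function.update_eq_self, ← Shape.zKet_eq_bKet, hz₂]
  rw [e₁] at hk
  rw [e₂] at hk'
  exact hF.sameOutcome h13 E hε hEz hk hk'

end Shape

/-! ## Part VI.  Sharpness: failure AT `ε = 1/(minFac(Q)² + 1)` — the damped rank-one measurement -/

section Damp

variable {X : Type*} [Fintype X] [DecidableEq X]

omit [DecidableEq X] in
/-- A non-negative real multiple of a positive semidefinite matrix is positive semidefinite. [folklore] -/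
theorem posSemidef_real_smul {A : Matrix X X ℂ} (hA : A.PosSemidef) {c : ℝ} (hc : 0 ≤ c) :
    (((c : ℝ) : ℂ) • A).PosSemidef := by
  refine Matrix.PosSemidef.of_dotProduct_mulVec_nonneg ?_ fun x => ?_
  · show (_ : Matrix X X ℂ)ᴴ = _
    rw [Matrix.conjTranspose_smul, hA.1.eq, Complex.star_def, Complex.conj_ofReal]
  · rw [Matrix.smul_mulVec, dotProduct_smul, smul_eq_mul]
    exact mul_nonneg (Complex.zero_le_real.2 hc) (hA.dotProduct_mulVec_nonneg x)

namespace POVM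

/-- **Damping** outcome `0` of a two-outcome measurement by `λ ∈ [0, 1]`: effects `λ·E₀` and
`1 − λ·E₀ = E₁ + (1 − λ)·E₀`. [cite: NielsenChuang2010, §2.2.6 p. 90] -/
noncomputable def damp (E : POVM X (Fin 2)) (l : ℝ) (hl0 : 0 ≤ l) (hl1 : l ≤ 1) : POVM X (Fin 2) where
  effect := fun k => if k = 0 then ((l : ℝ) : ℂ) • E.effect 0
    else E.effect 1 + (((1 - l : ℝ)) : ℂ) • E.effect 0
  posSemidef := fun k => by
    by_cases hk : k = 0
    · rw [if_pos hk]
      exact posSemidef_real_smul (E.posSemidef 0) hl0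
    · rw [if_neg hk]
      exact (E.posSemidef 1).add (posSemidef_real_smul (E.posSemidef 0) (sub_nonneg.2 hl1))
  sum_eq_one := by
    rw [Fin.sum_univ_two, if_pos rfl, if_neg (by decide), ← E.sum_eq_one, Fin.sum_univ_two,
      Complex.ofReal_sub, Complex.ofReal_one, sub_smul, one_smul]
    abel

/-- Damped weight of outcome `0`: `λ·w₀`. [cite: NielsenChuang2010, §2.2.6 p. 90] -/
theorem damp_weight_zero (E : POVM X (Fin 2)) {l : ℝ} (hl0 : 0 ≤ l) (hl1 : l ≤ 1) (φ : X → ℂ) :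
    (E.damp l hl0 hl1).weight φ 0 = ((l : ℝ) : ℂ) * E.weight φ 0 := by
  show star φ ⬝ᵥ ((if (0 : Fin 2) = 0 then ((l : ℝ) : ℂ) • E.effect 0
    else E.effect 1 + (((1 - l : ℝ)) : ℂ) • E.effect 0) *ᵥ φ) = _
  rw [if_pos rfl, Matrix.smul_mulVec, dotProduct_smul, smul_eq_mul]
  rfl

/-- Damped weight of outcome `1`: `w₁ + (1 − λ)·w₀`. [cite: NielsenChuang2010, §2.2.6 p. 90] -/
theorem damp_weight_one (E : POVM X (Fin 2)) {l : ℝ} (hl0 : 0 ≤ l) (hl1 : l ≤ 1) (φ : X → ℂ) :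
    (E.damp l hl0 hl1).weight φ 1 = E.weight φ 1 + (((1 - l : ℝ)) : ℂ) * E.weight φ 0 := by
  show star φ ⬝ᵥ ((if (1 : Fin 2) = 0 then ((l : ℝ) : ℂ) • E.effect 0
    else E.effect 1 + (((1 - l : ℝ)) : ℂ) • E.effect 0) *ᵥ φ) = _
  rw [if_neg (by decide), Matrix.add_mulVec, dotProduct_add, Matrix.smul_mulVec, dotProduct_smul,
    smul_eq_mul]
  rfl

/-- The two weights of a two-outcome measurement: `w₁ = ⟨φ|φ⟩ − w₀` (real parts). [cite: NielsenChuang2010, §2.2.6 p. 90] -/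
theorem weight_one_re_eq (E : POVM X (Fin 2)) (φ : X → ℂ) :
    (E.weight φ 1).re = (star φ ⬝ᵥ φ).re - (E.weight φ 0).re := by
  have h := E.sum_weight_re φ
  rw [Fin.sum_univ_two] at h
  linarith

/-- If outcome `0` was certain, it stays `ε`-almost certain after damping by `λ ≥ 1 − ε`.
[cite: NielsenChuang2010, §2.2.6 p. 90] -/
theorem damp_almostCertain_zero (E : POVM X (Fin 2)) {l ε : ℝ} (hl0 : 0 ≤ l) (hl1 : l ≤ 1)
    (hle : 1 - ε ≤ l) {φ : X → ℂ} (hc : E.Certain φ 0) : (E.damp l hl0 hl1).AlmostCertain ε φ 0 := by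
  unfold AlmostCertain
  unfold Certain at hc
  rw [E.damp_weight_zero hl0 hl1, hc, Complex.re_ofReal_mul]
  exact mul_le_mul_of_nonneg_right hle (star_dotProduct_self_re_nonneg φ)

/-- If outcome `0` had weight at most `μ⟨φ|φ⟩` and `λμ ≤ ε`, outcome `1` is `ε`-almost certain after damping.
[cite: NielsenChuang2010, §2.2.6 p. 90] -/
theorem damp_almostCertain_one (E : POVM X (Fin 2)) {l ε μ : ℝ} (hl0 : 0 ≤ l) (hl1 : l ≤ 1)
    {φ : X → ℂ} (hw : (E.weight φ 0).re ≤ μ * (star φ ⬝ᵥ φ).re) (hμ : l * μ ≤ ε) :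
    (E.damp l hl0 hl1).AlmostCertain ε φ 1 := by
  unfold AlmostCertain
  rw [E.damp_weight_one hl0 hl1, Complex.add_re, Complex.re_ofReal_mul, E.weight_one_re_eq]
  have hN := star_dotProduct_self_re_nonneg φ
  have h1 : l * (E.weight φ 0).re ≤ l * (μ * (star φ ⬝ᵥ φ).re) := mul_le_mul_of_nonneg_left hw hl0
  have h2 : l * μ * (star φ ⬝ᵥ φ).re ≤ ε * (star φ ⬝ᵥ φ).re := mul_le_mul_of_nonneg_right hμ hN
  nlinarith

end POVM

end Damp

namespace Shape

variable (S : Shape)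

/-- **The class seen from `|φ7.d⟩` of `S`:** an admissible instance of the same shape is either the SAME
state, or has normalised overlap² at most `1/minFac(Q)²` with it (orthogonal instances — in particular
`(b, v′ + 2D²p₁b)` — included): the geometric content of (Q) `Shape.rankOne_almostSureOn`.
[cite: ChenQuantumLattice2024, §3.5.5 pp. 33–37, Cond. C.3–C.5 p. 18] -/
theorem inst_phi7d_eq_or_overlap_le (h : S.Admissible) {b₂ v₂ : Fin (S.n + 1) → ℤ}
    (h₂ : (S.inst b₂ v₂).Admissible) :
    (S.inst b₂ v₂).phi7d = S.phi7d
      ∨ ‖star S.phi7d ⬝ᵥ (S.inst b₂ v₂).phi7d‖ ^ 2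
          ≤ 1 / ((Nat.minFac (S.Q : ℕ) : ℕ) : ℝ) ^ 2 * (star S.phi7d ⬝ᵥ S.phi7d).re
              * (star ((S.inst b₂ v₂).phi7d : (Fin (S.n + 1) → ZMod S.M) → ℂ)
                  ⬝ᵥ ((S.inst b₂ v₂).phi7d : (Fin (S.n + 1) → ZMod S.M) → ℂ)).re := by
  classical
  have hS : (S.inst S.b S.v').Admissible := h
  -- tail differences are multiples of `2p₁`
  have hμ : ∀ t : Fin S.n, ∃ μ : ℤ, S.b t.succ - b₂ t.succ = 2 * (S.p₁ : ℤ) * μ := by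
    intro t
    obtain ⟨a, ha⟩ := h.b_tail t.succ (Fin.succ_ne_zero t)
    obtain ⟨c, hc⟩ := h₂.b_tail t.succ (Fin.succ_ne_zero t)
    have hc' : b₂ t.succ = 2 * (S.p₁ : ℤ) * c := hc
    exact ⟨a - c, by rw [ha, hc']; ring⟩
  choose μ hμ using hμ
  by_cases hall : ∀ t : Fin S.n, ((S.Q : ℕ) : ℤ) ∣ μ t
  · -- `b₂ ≡ S.b (mod P)` coordinatewise
    have hb : ∀ i, ((S.P : ℕ) : ℤ) ∣ b₂ i - S.b i := by
      intro i
      rcases Fin.eq_zero_or_eq_succ i with rfl | ⟨t, rfl⟩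
      · have hb0 : b₂ 0 = -1 := h₂.b_head
        rw [hb0, h.b_head, sub_self]
        exact dvd_zero _
      · obtain ⟨c, hc⟩ := hall t
        refine ⟨-(2 * c), ?_⟩
        rw [S.P_coe]
        linear_combination (-1 : ℤ) * hμ t - (2 * (S.p₁ : ℤ)) * hc
    have hov := S.dot_phi7d_congr_b h hS h₂ hb
    by_cases hv : ∀ i, ((v₂ i : ℤ) : ZMod S.M) = ((S.v' i : ℤ) : ZMod S.M)
    · -- the same state
      left
      rw [S.phi7d_inst_congr_b v₂ hb]
      exact S.phi7d_inst_congr S.b S.v' v₂ hv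
    · -- orthogonal
      right
      have h0 : star S.phi7d ⬝ᵥ (S.inst b₂ v₂).phi7d = 0 := by
        have := hov
        rw [if_neg hv] at this
        exact this
      rw [h0, norm_zero, zero_pow two_ne_zero]
      have h1 := star_dotProduct_self_re_nonneg S.phi7d
      have h2 := star_dotProduct_self_re_nonneg ((S.inst b₂ v₂).phi7d : (Fin (S.n + 1) → ZMod S.M) → ℂ)
      have h3 : (0 : ℝ) ≤ 1 / ((Nat.minFac (S.Q : ℕ) : ℕ) : ℝ) ^ 2 := by positivity
      exact mul_nonneg (mul_nonneg h3 h1) h2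
  · -- some tail coordinate carries a shift not divisible by `Q`: small overlap
    right
    push Not at hall
    obtain ⟨t, ht⟩ := hall
    have hle := S.norm_dot_phi7_mul_minFac_le h (b₂ := S.b) (v₂ := S.v') (b₃ := b₂) (v₃ := v₂) hS h₂ t
      (hμ t) ht
    have hd : star S.phi7d ⬝ᵥ (S.inst b₂ v₂).phi7d
        = (((S.M : ℕ) : ℂ) * (S.D : ℕ)) ^ (S.n + 1) * (star S.phi7 ⬝ᵥ (S.inst b₂ v₂).phi7) :=
      S.dot_phi7d_inst_phi7 S.b S.v' b₂ v₂ h₂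
    have hnS : star S.phi7d ⬝ᵥ S.phi7d
        = (((S.M : ℕ) : ℂ) * (S.D : ℕ)) ^ (S.n + 1) * (((S.P : ℕ) : ℂ) * 2 ^ S.n) :=
      S.star_phi7d_dotProduct_phi7d_inst (b := S.b) (v := S.v') hS
    have hn₂ : star ((S.inst b₂ v₂).phi7d : (Fin (S.n + 1) → ZMod S.M) → ℂ)
          ⬝ᵥ ((S.inst b₂ v₂).phi7d : (Fin (S.n + 1) → ZMod S.M) → ℂ)
        = (((S.M : ℕ) : ℂ) * (S.D : ℕ)) ^ (S.n + 1) * (((S.P : ℕ) : ℂ) * 2 ^ S.n) :=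
      S.star_phi7d_dotProduct_phi7d_inst h₂
    set K : ℝ := (((S.M : ℕ) : ℝ) * (S.D : ℕ)) ^ (S.n + 1) with hK
    set A : ℝ := ‖star S.phi7 ⬝ᵥ (S.inst b₂ v₂).phi7‖ with hA
    set B : ℝ := ((S.P : ℕ) : ℝ) * 2 ^ S.n with hB
    set m : ℝ := ((Nat.minFac (S.Q : ℕ) : ℕ) : ℝ) with hm
    have hKnn : 0 ≤ K := by positivity
    have hAnn : 0 ≤ A := norm_nonneg _
    have hmpos : 0 < m := by
      have := Nat.minFac_pos (S.Q : ℕ)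
      positivity
    have hnorm : ‖star S.phi7d ⬝ᵥ (S.inst b₂ v₂).phi7d‖ = K * A := by
      rw [hd, norm_mul, norm_pow, norm_mul, Complex.norm_natCast, Complex.norm_natCast]
    have hcast : (((S.M : ℕ) : ℂ) * (S.D : ℕ)) ^ (S.n + 1) * (((S.P : ℕ) : ℂ) * 2 ^ S.n)
        = ((K * B : ℝ) : ℂ) := by
      rw [hK, hB]
      push_cast
      ring
    have hreS : (star S.phi7d ⬝ᵥ S.phi7d).re = K * B := by
      rw [hnS, hcast, Complex.ofReal_re]
    have hre₂ : (star ((S.inst b₂ v₂).phi7d : (Fin (S.n + 1) → ZMod S.M) → ℂ)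
          ⬝ᵥ ((S.inst b₂ v₂).phi7d : (Fin (S.n + 1) → ZMod S.M) → ℂ)).re = K * B := by
      rw [hn₂, hcast, Complex.ofReal_re]
    have h2' : K * A ≤ K * B / m := by
      rw [le_div_iff₀ hmpos]
      calc K * A * m = K * (A * m) := by ring
        _ ≤ K * B := mul_le_mul_of_nonneg_left hle hKnn
    have h3 : 0 ≤ K * A := mul_nonneg hKnn hAnn
    have key : (K * A) ^ 2 ≤ 1 / m ^ 2 * (K * B) * (K * B) :=
      calc (K * A) ^ 2 ≤ (K * B / m) ^ 2 := pow_le_pow_left₀ h3 h2' 2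
        _ = 1 / m ^ 2 * (K * B) * (K * B) := by
          field_simp
    calc ‖star S.phi7d ⬝ᵥ (S.inst b₂ v₂).phi7d‖ ^ 2 = (K * A) ^ 2 := by rw [hnorm]
      _ ≤ 1 / m ^ 2 * (K * B) * (K * B) := key
      _ = 1 / m ^ 2 * (star S.phi7d ⬝ᵥ S.phi7d).re
            * (star ((S.inst b₂ v₂).phi7d : (Fin (S.n + 1) → ZMod S.M) → ℂ)
                ⬝ᵥ ((S.inst b₂ v₂).phi7d : (Fin (S.n + 1) → ZMod S.M) → ℂ)).re := by
          rw [hreS, hre₂]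

/-- **Failure AT the threshold `1/(minFac(Q)² + 1)`** (every admissible `Q`, every class `U`): the rank-one
measurement along `ψ = |φ7.d⟩` of `S` DAMPED by `1 − ε⋆`, i.e. `{(1 − ε⋆)|ψ⟩⟨ψ|/⟨ψ|ψ⟩, 1 − (1 − ε⋆)|ψ⟩⟨ψ|/⟨ψ|ψ⟩}`
with `ε⋆ = 1/(minFac(Q)² + 1)`, is `ε⋆`-almost sure on the class (same state: outcome `0` with weight exactly
`(1 − ε⋆)⟨ψ|ψ⟩`; any other instance: outcome `1` with weight `≥ ⟨φ|φ⟩(1 − (1 − ε⋆)/minFac(Q)²) = (1 − ε⋆)⟨φ|φ⟩`)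
and separates `S` (outcome `0`) from `(b, v′ + 2D²p₁b)` (outcome `1`, certain).  This improves the failure
point `1/minFac(Q)²` of (Q) `Shape.step8_povm_ceiling_fails_at_inv_minFac_sq` to `1/(minFac(Q)² + 1)`, which
for prime `Q ≥ 13` MEETS the ceiling `ε(Q² + 1) < 1` of `Shape.step8_povm_ceiling_prime`.  Adjudication, not a
claim of the source; HONEST FRAMING: about a WITHDRAWN algorithm.
[cite: ChenQuantumLattice2024, §3.5.5 pp. 33–37, Lemma 3.13 p. 32; NielsenChuang2010, §2.2.6 p. 90] -/
theorem step8_povm_ceiling_fails_at_threshold (h : S.Admissible) (U : Finset (Fin (S.n + 1))) :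
    ∃ (E : POVM (Fin (S.n + 1) → ZMod S.M) (Fin 2)) (k k' : Fin 2),
      S.AlmostSureOn (1 / (((Nat.minFac (S.Q : ℕ) : ℕ) : ℝ) ^ 2 + 1)) U E ∧ k ≠ k'
      ∧ E.AlmostCertain (1 / (((Nat.minFac (S.Q : ℕ) : ℕ) : ℝ) ^ 2 + 1)) S.phi7d k
      ∧ E.AlmostCertain (1 / (((Nat.minFac (S.Q : ℕ) : ℕ) : ℝ) ^ 2 + 1))
          (S.inst S.b (fun i => S.v' i + 2 * (S.D : ℤ) * S.D * S.p₁ * S.b i)).phi7d k' := by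
  classical
  set m : ℝ := ((Nat.minFac (S.Q : ℕ) : ℕ) : ℝ) with hm
  have hmpos : 0 < m := by
    have := Nat.minFac_pos (S.Q : ℕ)
    positivity
  have hε0 : (0 : ℝ) ≤ 1 / (m ^ 2 + 1) := by positivity
  have hε1 : 1 / (m ^ 2 + 1) ≤ 1 := by
    rw [div_le_one (by positivity)]
    nlinarith
  have hl0 : (0 : ℝ) ≤ 1 - 1 / (m ^ 2 + 1) := sub_nonneg.2 hε1
  have hl1 : 1 - 1 / (m ^ 2 + 1) ≤ 1 := sub_le_self _ hε0
  have hψ : S.phi7d ≠ 0 := S.phi7d_ne_zero h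
  have hkey : (1 - 1 / (m ^ 2 + 1)) * (1 / m ^ 2) ≤ 1 / (m ^ 2 + 1) := by
    rw [show (1 - 1 / (m ^ 2 + 1)) * (1 / m ^ 2) = 1 / (m ^ 2 + 1) by field_simp; ring]
  refine ⟨(rankOnePOVM S.phi7d).damp (1 - 1 / (m ^ 2 + 1)) hl0 hl1, 0, 1, ?_, by decide, ?_, ?_⟩
  · rintro b₂ v₂ ⟨-, h₂⟩
    rcases S.inst_phi7d_eq_or_overlap_le h h₂ with hsame | hov
    · refine ⟨0, ?_⟩
      rw [hsame]
      exact POVM.damp_almostCertain_zero _ hl0 hl1 le_rfl (rankOnePOVM_certain_self hψ)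
    · refine ⟨1, POVM.damp_almostCertain_one _ hl0 hl1 ?_ hkey⟩
      rw [rankOnePOVM_weight_zero, Complex.ofReal_re]
      have hpos := star_dotProduct_self_re_pos hψ
      rw [inv_mul_le_iff₀ hpos]
      calc ‖star S.phi7d ⬝ᵥ (S.inst b₂ v₂).phi7d‖ ^ 2
          ≤ 1 / m ^ 2 * (star S.phi7d ⬝ᵥ S.phi7d).re
              * (star ((S.inst b₂ v₂).phi7d : (Fin (S.n + 1) → ZMod S.M) → ℂ)
                  ⬝ᵥ ((S.inst b₂ v₂).phi7d : (Fin (S.n + 1) → ZMod S.M) → ℂ)).re := hov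
        _ = (star S.phi7d ⬝ᵥ S.phi7d).re * (1 / m ^ 2
              * (star ((S.inst b₂ v₂).phi7d : (Fin (S.n + 1) → ZMod S.M) → ℂ)
                  ⬝ᵥ ((S.inst b₂ v₂).phi7d : (Fin (S.n + 1) → ZMod S.M) → ℂ)).re) := by ring
  · exact POVM.damp_almostCertain_zero _ hl0 hl1 le_rfl (rankOnePOVM_certain_self hψ)
  · obtain ⟨-, h1⟩ := S.rankOne_separates h
    refine POVM.damp_almostCertain_one _ hl0 hl1 (μ := 0) ?_ (by rw [mul_zero]; exact hε0)
    rw [zero_mul]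
    have hw := (rankOnePOVM S.phi7d).weight_one_re_eq
      ((S.inst S.b (fun i => S.v' i + 2 * (S.D : ℤ) * S.D * S.p₁ * S.b i)).phi7d
        : (Fin (S.n + 1) → ZMod S.M) → ℂ)
    unfold POVM.Certain at h1
    rw [h1] at hw
    linarith

/-- **Prime `Q ≥ 13`: the tolerance threshold is EXACTLY `1/(Q² + 1)`.**  Ceiling for every `ε` with
`ε·(Q² + 1) < 1` (`Shape.step8_povm_ceiling_prime`) and failure at `ε = 1/(Q² + 1)`
(`Shape.step8_povm_ceiling_fails_at_threshold`) — closing the window `[1/(4Q²), 1/Q²]` and the open factor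
`4` of (Q) `Shape.step8_povm_ceiling_order_prime` (which covers all primes; the present exact constant needs
`Q ≥ 13`: for `Q ≤ 11` the Gram step `H ≥ 6` of `MUBFrames.six_le_card` is not available and the window
of (Q) stands).  Adjudication, not a claim of the source; HONEST FRAMING: a theorem about a WITHDRAWN
algorithm, not progress on any lattice problem. [cite: ChenQuantumLattice2024, Lemma 3.13 pp. 32–34,
§3.5.8 pp. 33–34, §3.5.5 pp. 33–37; NielsenChuang2010, §2.2.6 p. 90, Box 2.3 p. 87] -/
theorem step8_povm_ceiling_threshold_prime (h : S.Admissible) (hQ : (S.Q : ℕ).Prime)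
    (h13 : 13 ≤ (S.Q : ℕ)) (U : Finset (Fin (S.n + 1))) :
    (∀ {κ : Type} [Fintype κ] [DecidableEq κ] (t₁ : Fin S.n), t₁.succ ∈ U →
        ∀ (E : POVM (Fin (S.n + 1) → ZMod S.M) κ) {ε : ℝ}, ε * (((S.Q : ℕ) : ℝ) ^ 2 + 1) < 1 →
          S.AlmostSureOn ε U E →
            ∀ k k' : κ, E.AlmostCertain ε S.phi7d k →
              E.AlmostCertain ε (S.inst S.b (fun i => S.v' i + 2 * (S.D : ℤ) * S.D * S.p₁ * S.b i)).phi7d k'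
                → k = k')
    ∧ ∃ (E : POVM (Fin (S.n + 1) → ZMod S.M) (Fin 2)) (k k' : Fin 2),
        S.AlmostSureOn (1 / (((S.Q : ℕ) : ℝ) ^ 2 + 1)) U E ∧ k ≠ k'
        ∧ E.AlmostCertain (1 / (((S.Q : ℕ) : ℝ) ^ 2 + 1)) S.phi7d k
        ∧ E.AlmostCertain (1 / (((S.Q : ℕ) : ℝ) ^ 2 + 1))
            (S.inst S.b (fun i => S.v' i + 2 * (S.D : ℤ) * S.D * S.p₁ * S.b i)).phi7d k' := by
  refine ⟨fun t₁ ht₁ E _ hε hE _ _ hk hk' => S.step8_povm_ceiling_prime h hQ h13 U t₁ ht₁ E hε hE hk hk',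
    ?_⟩
  have hmf : Nat.minFac (S.Q : ℕ) = (S.Q : ℕ) := hQ.minFac_eq
  have := S.step8_povm_ceiling_fails_at_threshold h U
  rw [hmf] at this
  exact this

/-- **The threshold as a number:** for prime `Q ≥ 13` and any class with an unknown tail coordinate, the
set of tolerances `ε` at which EVERY `ε`-almost-sure two-outcome measurement gives `S` and
`(b, v′ + 2D²p₁b)` the same almost-certain outcome is exactly the half-line `ε < 1/(Q² + 1)`.
Adjudication; HONEST FRAMING as above. [cite: ChenQuantumLattice2024, Lemma 3.13 pp. 32–34, §3.5.8 pp. 33–34] -/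
theorem step8_povm_sameOutcome_iff_lt_threshold (h : S.Admissible) (hQ : (S.Q : ℕ).Prime)
    (h13 : 13 ≤ (S.Q : ℕ)) (U : Finset (Fin (S.n + 1))) (t₁ : Fin S.n) (ht₁ : t₁.succ ∈ U)
    (ε : ℝ) :
    (∀ (E : POVM (Fin (S.n + 1) → ZMod S.M) (Fin 2)), S.AlmostSureOn ε U E →
        ∀ k k' : Fin 2, E.AlmostCertain ε S.phi7d k →
          E.AlmostCertain ε (S.inst S.b (fun i => S.v' i + 2 * (S.D : ℤ) * S.D * S.p₁ * S.b i)).phi7d k'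
            → k = k')
      ↔ ε < 1 / (((S.Q : ℕ) : ℝ) ^ 2 + 1) := by
  have hpos : (0 : ℝ) < ((S.Q : ℕ) : ℝ) ^ 2 + 1 := by positivity
  constructor
  · intro H
    by_contra hge
    push Not at hge
    obtain ⟨E, k, k', hE, hkk, hk, hk'⟩ := (S.step8_povm_ceiling_threshold_prime h hQ h13 U).2
    -- monotonicity in `ε`: an `ε⋆`-almost-sure measurement is `ε`-almost sure for `ε ≥ ε⋆`
    have mono : ∀ {φ : (Fin (S.n + 1) → ZMod S.M) → ℂ} {j : Fin 2},
        E.AlmostCertain (1 / (((S.Q : ℕ) : ℝ) ^ 2 + 1)) φ j → E.AlmostCertain ε φ j := by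
      intro φ j hj
      unfold POVM.AlmostCertain at hj ⊢
      have hN := star_dotProduct_self_re_nonneg φ
      nlinarith
    exact hkk (H E (fun b₂ v₂ hI => (hE b₂ v₂ hI).imp fun j hj => mono hj) k k' (mono hk) (mono hk'))
  · intro hlt E hE k k' hk hk'
    have hε : ε * (((S.Q : ℕ) : ℝ) ^ 2 + 1) < 1 := by rwa [lt_div_iff₀ hpos] at hlt
    exact S.step8_povm_ceiling_prime h hQ h13 U t₁ ht₁ E hε hE hk hk'

end Shape

end Literature.Computability.Cryptography.Chen2024
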